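import Mathlib.Analysis.InnerProductSpace.Spectrum
import Mathlib.Analysis.MeanInequalities
import Mathlib.Analysis.MeanInequalitiesPow
import Literature.MathematicalPhysics.QuantumLattice.KomaTasakiTower

/-!
# Koma–Tasaki 1994, Theorem 2.5 (2.30): the order parameter of the symmetry-breaking
# low-lying states (the `U(1)` case `√2` and the `SU(2)` case `√3`, PROVED)

T. Koma, H. Tasaki, *Symmetry breaking and finite-size effects in quantum many-body systems*,
J. Stat. Phys. **76** (1994) 745–803 (`KomaTasaki1994`, held as `paper:arxiv-cond-mat_9708132`),
Theorem 2.5, second half, eq. (2.30): for the symmetry-breaking trial states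
`Ξ^{(k)}_Λ = (2k+1)^{-1/2} (Φ_Λ + Σ_{M=1}^{k} (Ψ^{(M)}_Λ + Ψ^{(-M)}_Λ))` ((2.27); tree:
`U1System.xiState`) built on an eigenstate `Φ_Λ` with obscured symmetry breaking
((2.17): `⟨Φ, (O^{(1)})² Φ⟩ = ⟨Φ, (O^{(2)})² Φ⟩ ≥ (μ o N)²`; tree: `IsLROEigenstate`),

  `lim_{k → ∞} lim_{Λ ↑ ℤ^d} N⁻¹ (Ξ^{(k)}_Λ, O^{(1)}_Λ Ξ^{(k)}_Λ) ≥ √2 μ o`      (2.30)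

"where the prefactor `√2` is modified if the model has a higher symmetry. For example, we
replace `√2` with `√3` when the model has an `SU(2)` symmetry."  The companion identity (2.29),
`(Ξ^{(k)}, O^{(2)} Ξ^{(k)}) = 0`, is `theorem_2_5_orderTwo_holds` of `KomaTasakiSSB.lean`; Theorems
2.2–2.4 are proved in `KomaTasakiSSB.lean`, `KomaTasakiSSBProofs.lean`,
`KomaTasakiSSBTowerProofs.lean`.
This file PROVES (2.30) in the `U(1)` case, in a quantitative finite-volume form from which the
double limit follows, over the abstract `U1System` of `KomaTasakiSSB.lean` (commutators, norms and
the charge operator only — so it applies verbatim to Jordan–Wigner matrices of lattice fermions),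
and then the `SU(2)` refinement with `√3` (KT93 Corollary 7.2 = Theorem 7.3 + Theorem 6.1; Tasaki,
J. Stat. Phys. **174** (2019) Theorem 3.4) over an `SU2Datum` (a third order-operator density and the
generators rotating `(O^{(1)}, O^{(2)}, O^{(3)})` as a vector, KT93 §2 iv), v), §7 i'')) — see the last
section of the file and `## The SU(2) case` below.

## What is proved

* `U1System.theorem_2_5_orderOne_fin` (finite volume, every `k ≥ 1`, every `N = |Λ|`):
  `0 ≤ Re (Ξ^{(k)}, O^{(1)} Ξ^{(k)})` and
  `(2 (μ o N)²)^k - k² o (2 o N)^{2k-1} ≤ ( (2k+1)/(2k) · Re (Ξ^{(k)}, O^{(1)} Ξ^{(k)}) )^{2k}`,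
  i.e. `N⁻¹ Re (Ξ^{(k)}, O^{(1)} Ξ^{(k)})`
  `≥ (2k/(2k+1)) · ((2μ²o²)^k - k² 2^{2k-1} o^{2k}/N)₊^{1/(2k)}` (positive part, `2k`-th root).
* `theorem_2_5_orderOne` / `theorem_2_5_orderOne_holds` (KT (2.30) as printed, `U(1)` case, in
  `ε`–`k₀`–`N₀` form, uniform over all systems with the given `μ`, `o`): for every `ε > 0` there is
  `k₀` such that for every `k ≥ k₀` there is `N₀` with
  `N⁻¹ Re (Ξ^{(k)}, O^{(1)} Ξ^{(k)}) ≥ √2 μ o - ε` whenever `N ≥ N₀`;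
  `theorem_2_5_orderOne_seq` restates it along a sequence of lattices with `N_j → ∞`
  (`∀ ε > 0, ∃ k₀, ∀ k ≥ k₀, ∀ᶠ j, …`), the shape requested by the `sr-mbsolver` M2
  one-point-ceiling row (Koma–Tasaki transport of two-point long-range order to a one-point order
  parameter).

## The printed proof and the one formalised here

KT94 prove (2.30) by quoting Koma–Tasaki, Commun. Math. Phys. **158** (1993) 191–214
(`KomaTasaki1993`), Theorem 7.3 with (7.25)–(7.26) and Theorem 6.1 ("One only has to combine (7.26)
of [KT93] and Theorem 6.1 of [KT93]", KT94 proof of Thm 2.5, arXiv p. 9).  We follow KT93 §7: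

1. KT94 proof of Thm 2.5, first display / KT93 (7.25): by charge bookkeeping ((2.16):
   `C (O^±)^M Φ = (c ± M) (O^±)^M Φ`, orthogonality of distinct charges) the only surviving matrix
   elements are `(2k+1) (Ξ^{(k)}, O^+ Ξ^{(k)}) = Σ_{M=1}^{k} ( ‖(O^+)^M Φ‖/‖(O^+)^{M-1} Φ‖
   + ‖(O^-)^M Φ‖/‖(O^-)^{M-1} Φ‖ )` (`inner_xiVec_orderPlus`), and the arithmetic–geometric mean
   inequality with telescoping gives `≥ 2k (‖(O^+)^k Φ‖ ‖(O^-)^k Φ‖)^{1/(2k)}` (KT93 (7.25):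
   "we bounded the arithmetic mean from below by the geometric mean").
2. KT93 Lemma 7.5 (reordering, commutator cost `O(N^{2n-1})`): here in the form
   `‖(O^∓)^n (O^±)^n - Q^n‖ ≤ n² o (2 o N)^{2n-1}` with `Q = (O^{(1)})² + (O^{(2)})²`
   (`norm_pow_mul_pow_sub_pow_le`, from `O^∓ O^± = Q ± i[O^{(1)}, O^{(2)}]`,
   `‖[O^{(1)}, O^{(2)}]‖ ≤ 2 o² N` by hypothesis i), `‖[O^∓, Q]‖ ≤ 8 o³ N²`).
3. KT93 Lemma 7.4 (Jensen: `⟨(O^{(1)})^{2n}⟩ ≥ ⟨(O^{(1)})²⟩^n`): here for the positive operator `Q`,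
   `⟨Φ, Q^n Φ⟩ ≥ ⟨Φ, Q Φ⟩^n = (2 ⟨Φ, (O^{(1)})² Φ⟩)^n ≥ (2 μ² o² N²)^n` (spectral theorem in finite
   dimension + the power-mean inequality, `pow_re_inner_le_re_inner_pow`; the equality uses (2.17)).
   DEVIATION (shorter road, stated): KT93 route the constant through Theorem 6.1 (rotation
   averaging, which yields the larger support radius `m* ≥ √2 σ` of the order-parameter
   distribution and is what gives `√3` under `SO(3)`); for the printed `U(1)` constant `√2 μ o` of
   (2.30) Jensen for `Q` already suffices, because `⟨Q⟩ = 2⟨(O^{(1)})²⟩` by (2.17).  The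
   `SU(2)`/`SO(3)` refinement `√3 μ o`
   (KT94 remark after Thm 2.5; KT93 Thm 6.1, Cor. 7.2; Tasaki, J. Stat. Phys. 174 (2019) Thm 3.4)
   needs KT93's rotation average of degree-`2k` non-commutative moments; it is proved in the last
   section of this file (see `## The SU(2) case` below).
4. Assembly as in KT93 (7.26): `‖(O^±)^k Φ‖² ≥ (2μ²o²N²)^k - k² o (2oN)^{2k-1}`, hence the
   finite-volume bound, hence (2.30) by `N → ∞` then `k → ∞`.

Hypotheses used: only i) (`[o^{(α)}_x, o^{(β)}_y] = 0`, `x ≠ y`), iii) (`‖o_x‖ ≤ o`), the charge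
relations (2.14)/(2.16) and iv) (2.17) — the Hamiltonian, the range `r` and the size conditions
(2.20)–(2.21) do not enter (in KT they only guarantee `Ψ^{(M)} ≠ 0`, which here follows from the
lower bound itself whenever that bound is positive, and the inequality is trivial otherwise).
Finite dimensionality of the Hilbert space (KT: `⊗_x 𝓗_x`, finite-dimensional) is used for the
spectral decomposition of `Q` in step 3.

## The `SU(2)` case (`√3`): what is proved and how

* `SU2Datum sys` (structure): KT93's `SU(2)` setting on top of a `U1System` — densities `o^{(3)}_x`
  (self-adjoint, `‖o^{(3)}_x‖ ≤ o`, iv) commuting with all densities at other sites) and generators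
  `X^{(1)} = J 0`, `X^{(2)} = J 1`, which with `X^{(3)} = C_Λ` satisfy v)
  `[X^{(j)}, O^{(k)}] = i Σ_l ε_{jkl} O^{(l)}` (KT93 (2.16)); the state hypothesis i'')
  `X^{(j)} Φ = 0` enters the theorems as `∀ a, d.J a Φ = 0`.
* `SU2Datum.theorem_2_5_orderOne_fin` (finite volume, every `k ≥ 1`, every `N`):
  `(3 (μ o N)²)^k/(2k+1) - (8k² 3^k + 8k³ 4^k + k² 4^k) o^{2k} N^{2k-1}`
  `≤ ((2k+1)/(2k) · Re (Ξ^{(k)}, O^{(1)} Ξ^{(k)}))^{2k}`;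
  `theorem_2_5_orderOne_su2` / `theorem_2_5_orderOne_su2_holds` / `theorem_2_5_orderOne_su2_seq`:
  KT94 (2.30) with `√3 μ o` in `ε`–`k₀`–`N₀` form and along sequences `N_j → ∞`.
* Proof = KT93 Theorem 6.1 ((6.11)–(6.14)) and Lemma 7.5, with ONE deviation in technique (same
  statement): KT93/Tasaki obtain the factor `G_k = (4π)⁻¹∫_{S²} z^{2k} dΩ = 1/(2k+1)` (KT93 (6.9),
  Tasaki 2019 Lemma 4.3) by averaging `⟨(x O^{(1)} + y O^{(2)} + z O^{(3)})^{2k}⟩` over the unit sphere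
  with the finite rotations `U_Λ(x,y,z)` (6.12).  Here the same average is performed
  INFINITESIMALLY and one factor `(O)² = Σ_α (O^{(α)})²` at a time: `(O)²` commutes exactly with the
  generators, so for `W = ((O)²)^j` and any word `S`, `⟨Φ, W [X, S] Φ⟩ = 0` (`X Φ = 0`,
  `X` symmetric; `inner_mul_comm_eq_zero`); applied to `S = O^{(b)} (O^{(1)})^{2K-1}` with
  `[X, O^{(b)}] = ±i O^{(1)}`, `[X, O^{(1)}] = ∓i O^{(b)}` this gives
  `⟨W (O^{(1)})^{2K}⟩ = Σ_p ⟨W O^{(b)} (O^{(1)})^p O^{(b)} (O^{(1)})^{2K-2-p}⟩` (`inner_mul_pow_eq_sum`),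
  i.e. `(2K-1) ⟨W (O^{(b)})² (O^{(1)})^{2K-2}⟩ = ⟨W (O^{(1)})^{2K}⟩ + O(N^{-1})` after reordering
  (KT93 Lemma 6.3; `rot_estimate`).  Peeling `((O)²)^{k} = ((O)²)^{k-1}((O^{(1)})² + (O^{(2)})² +
  (O^{(3)})²)` `k` times telescopes `Π_K (2K+1)/(2K-1) = 2k+1`:
  `⟨((O)²)^k⟩ ≤ (2k+1) ⟨(O^{(1)})^{2k}⟩ + O(N^{2k-1})` (`SU2Datum.stepS`), and Jensen
  (`pow_re_inner_le_re_inner_pow`) gives `⟨((O)²)^k⟩ ≥ ⟨(O)²⟩^k = (3⟨(O^{(1)})²⟩)^k ≥ (3(μoN)²)^k`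
  — this is exactly KT93 (6.14) with `G_k = 1/(2k+1)`.  The `U(1)` step `⟨Q^k⟩ ≥ b_k ⟨(O^{(1)})^{2k}⟩
  - O(N^{2k-1})`, `b_k = Π_K 2K/(2K-1) ≥ 1` (KT93 Lemma 7.5 (7.18)–(7.19)) is obtained the same way
  with the generator `C` alone (`U1System.stepQ`); then `‖(O^±)^k Φ‖² ≈ ⟨Q^k⟩`
  (`norm_pow_mul_pow_sub_pow_le`) and the assembly (7.25)–(7.26) (`theorem_2_5_orderOne_fin_of_le`)
  are those of the `U(1)` case.  No sphere integral, Haar measure or exponential map is needed, and of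
  KT93's hypotheses only iv), v) for `j = 2, 3`, i'') for `j = 2` and the `C`-eigenvector property of
  `Φ` are used (the `su(2)` relations (2.15) and vi) are not).

## Mathlib / tree search

`lean search theorem_2_5_orderOne|orderOne|KomaTasaki1993`: KT93 is cited in `HeisenbergOrder.lean`
(Thm 2.1/Cor 2.2 as facts) and `HeisenbergNeelGapBound.lean` (§7 (7.5)–(7.9)); nothing on
(7.25)–(7.26) or KT94 (2.30).  Reused from `KomaTasakiSSBProofs.lean` / `KomaTasakiTower.lean`
(proofs of Thms 2.3–2.4): `norm_orderPlus_le`, `norm_comm_order_le`, `norm_pow_le_of_le`,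
`norm_order_le`.  (Its `growth` lemma — KT94 §4
Lemma 4.1, `‖(O^+)^{m+1}Φ‖ ≥ s ‖(O^+)^mΦ‖` with `s² = 2(μoN)² - 2o²N - 4o²N·M` — would give (2.30)
ratio by ratio as well; we keep KT93's own (7.25)–(7.26) route, which is the one KT94 cite.)
Mathlib: `LinearMap.IsSymmetric.eigenvectorBasis` /
`apply_eigenvectorBasis` (spectral theorem), `Real.pow_arith_mean_le_arith_mean_pow` (power means),
`Real.geom_mean_le_arith_mean_weighted` (AM–GM), `Finset.prod_range_succ` (telescoping by hand).
-/

noncomputable section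

open Complex Finset Filter
open scoped InnerProductSpace ComplexConjugate Topology

namespace Literature.MathematicalPhysics.QuantumLattice.KomaTasaki

universe u v

/-! ### Generic operator lemmas (bounded operators on a complex inner-product space) -/

section Generic

variable {E : Type v} [NormedAddCommGroup E] [InnerProductSpace ℂ E]

/-- Commutator with a power: `‖A Q^k - Q^k A‖ ≤ k c β^k` if `‖Q‖ ≤ β` and `‖A Q - Q A‖ ≤ c β`
(`[A, Q^{k+1}] = [A, Q^k] Q + Q^k [A, Q]`). [folklore] -/
private theorem norm_comm_pow_le (A Q : E →L[ℂ] E) {β c : ℝ} (hβ : 0 ≤ β) (hc : 0 ≤ c)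
    (hQ : ‖Q‖ ≤ β) (hAQ : ‖A * Q - Q * A‖ ≤ c * β) :
    ∀ k : ℕ, ‖A * Q ^ k - Q ^ k * A‖ ≤ k * c * β ^ k
  | 0 => by simp
  | k + 1 => by
    have ih := norm_comm_pow_le A Q hβ hc hQ hAQ k
    have hQk : ‖Q ^ k‖ ≤ β ^ k := norm_pow_le_of_le hQ k
    have hsplit : A * Q ^ (k + 1) - Q ^ (k + 1) * A =
        (A * Q ^ k - Q ^ k * A) * Q + Q ^ k * (A * Q - Q * A) := by
      rw [pow_succ]; noncomm_ring
    rw [hsplit]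
    calc ‖(A * Q ^ k - Q ^ k * A) * Q + Q ^ k * (A * Q - Q * A)‖
        ≤ ‖A * Q ^ k - Q ^ k * A‖ * ‖Q‖ + ‖Q ^ k‖ * ‖A * Q - Q * A‖ :=
          (norm_add_le _ _).trans (add_le_add (norm_mul_le _ _) (norm_mul_le _ _))
      _ ≤ (k * c * β ^ k) * β + β ^ k * (c * β) :=
          add_le_add (mul_le_mul ih hQ (norm_nonneg _)
              (mul_nonneg (mul_nonneg (Nat.cast_nonneg k) hc) (pow_nonneg hβ k)))
            (mul_le_mul hQk hAQ (norm_nonneg _) (pow_nonneg hβ k))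
      _ = ((k + 1 : ℕ) : ℝ) * c * β ^ (k + 1) := by push_cast; ring

/-- **Reordering cost** (KT93 Lemma 7.5 in operator form): if `‖A‖, ‖B‖ ≤ α`, `‖Q‖ ≤ α²`,
`‖A B - Q‖ ≤ δ α` and `‖[A, Q]‖ ≤ 2 δ α²`, then `‖A^{k+1} B^{k+1} - Q^{k+1}‖ ≤ (k+1)² δ α^{2k+1}`
(induction on `A^{k+2} B^{k+2} - Q^{k+2} = A (A^{k+1} B^{k+1} - Q^{k+1}) B + [A, Q^{k+1}] B
+ Q^{k+1} (A B - Q)`). [cite: KomaTasaki1993, Lemma 7.5 (7.18)–(7.21)] -/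
theorem norm_pow_mul_pow_sub_pow_le (A B Q : E →L[ℂ] E) {α δ : ℝ} (hα : 0 ≤ α) (hδ : 0 ≤ δ)
    (hA : ‖A‖ ≤ α) (hB : ‖B‖ ≤ α) (hQ : ‖Q‖ ≤ α ^ 2) (hAB : ‖A * B - Q‖ ≤ δ * α)
    (hAQ : ‖A * Q - Q * A‖ ≤ 2 * δ * α ^ 2) :
    ∀ k : ℕ, ‖A ^ (k + 1) * B ^ (k + 1) - Q ^ (k + 1)‖ ≤ ((k : ℝ) + 1) ^ 2 * δ * α ^ (2 * k + 1)
  | 0 => by simpa using hAB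
  | k + 1 => by
    have ih := norm_pow_mul_pow_sub_pow_le A B Q hα hδ hA hB hQ hAB hAQ k
    have hcomm : ‖A * Q ^ (k + 1) - Q ^ (k + 1) * A‖ ≤ (k + 1 : ℕ) * (2 * δ) * (α ^ 2) ^ (k + 1) :=
      norm_comm_pow_le A Q (sq_nonneg α) (by positivity) hQ (by simpa [mul_assoc] using hAQ) (k + 1)
    have hQk : ‖Q ^ (k + 1)‖ ≤ (α ^ 2) ^ (k + 1) := norm_pow_le_of_le hQ (k + 1)
    have hid : ∀ P R S : E →L[ℂ] E, A * P * (R * B) - S * Q =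
        A * (P * R - S) * B + (A * S - S * A) * B + S * (A * B - Q) := by
      intro P R S; noncomm_ring
    have hsplit : A ^ (k + 2) * B ^ (k + 2) - Q ^ (k + 2) =
        A * (A ^ (k + 1) * B ^ (k + 1) - Q ^ (k + 1)) * B
          + (A * Q ^ (k + 1) - Q ^ (k + 1) * A) * B + Q ^ (k + 1) * (A * B - Q) := by
      rw [show A ^ (k + 2) = A * A ^ (k + 1) from pow_succ' A (k + 1),
        show B ^ (k + 2) = B ^ (k + 1) * B from pow_succ B (k + 1),
        show Q ^ (k + 2) = Q ^ (k + 1) * Q from pow_succ Q (k + 1)]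
      exact hid _ _ _
    rw [hsplit]
    have h1 : ‖A * (A ^ (k + 1) * B ^ (k + 1) - Q ^ (k + 1)) * B‖
        ≤ α * (((k : ℝ) + 1) ^ 2 * δ * α ^ (2 * k + 1)) * α := by
      calc _ ≤ ‖A‖ * ‖A ^ (k + 1) * B ^ (k + 1) - Q ^ (k + 1)‖ * ‖B‖ :=
            (norm_mul_le _ _).trans (mul_le_mul_of_nonneg_right (norm_mul_le _ _) (norm_nonneg _))
        _ ≤ α * (((k : ℝ) + 1) ^ 2 * δ * α ^ (2 * k + 1)) * α := by
            apply mul_le_mul (mul_le_mul hA ih (norm_nonneg _) hα) hB (norm_nonneg _)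
            exact mul_nonneg hα (by positivity)
    have h2 : ‖(A * Q ^ (k + 1) - Q ^ (k + 1) * A) * B‖
        ≤ ((k + 1 : ℕ) * (2 * δ) * (α ^ 2) ^ (k + 1)) * α :=
      (norm_mul_le _ _).trans (mul_le_mul hcomm hB (norm_nonneg _) (by positivity))
    have h3 : ‖Q ^ (k + 1) * (A * B - Q)‖ ≤ (α ^ 2) ^ (k + 1) * (δ * α) :=
      (norm_mul_le _ _).trans (mul_le_mul hQk hAB (norm_nonneg _) (by positivity))
    calc _ ≤ ‖A * (A ^ (k + 1) * B ^ (k + 1) - Q ^ (k + 1)) * B‖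
          + ‖(A * Q ^ (k + 1) - Q ^ (k + 1) * A) * B‖ + ‖Q ^ (k + 1) * (A * B - Q)‖ :=
            norm_add₃_le
      _ ≤ α * (((k : ℝ) + 1) ^ 2 * δ * α ^ (2 * k + 1)) * α
          + ((k + 1 : ℕ) * (2 * δ) * (α ^ 2) ^ (k + 1)) * α + (α ^ 2) ^ (k + 1) * (δ * α) :=
            add_le_add (add_le_add h1 h2) h3
      _ = (((k + 1 : ℕ) : ℝ) + 1) ^ 2 * δ * α ^ (2 * (k + 1) + 1) := by
            push_cast; ring

/-- Powers of a symmetric operator are symmetric: `⟪T^k x, y⟫ = ⟪x, T^k y⟫`. [folklore] -/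
private theorem inner_pow_apply_left_of_isSymmetric (T : E →L[ℂ] E)
    (hT : (T : E →ₗ[ℂ] E).IsSymmetric) (k : ℕ) (x y : E) : ⟪(T ^ k) x, y⟫_ℂ = ⟪x, (T ^ k) y⟫_ℂ := by
  induction k generalizing x y with
  | zero => simp
  | succ k ih =>
    have h1 : (T ^ (k + 1)) x = (T ^ k) (T x) := by
      rw [pow_succ, mul_apply_eq_comp]
    have h2 : (T ^ (k + 1)) y = T ((T ^ k) y) := by
      rw [pow_succ', mul_apply_eq_comp]
    rw [h1, h2, ih]
    exact hT x _

/-- Eigenvectors: `T^k v = λ^k v` if `T v = λ v`. [folklore] -/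
private theorem pow_apply_of_apply_eq_smul (T : E →L[ℂ] E) {v : E} {c : ℂ} (hv : T v = c • v) :
    ∀ k : ℕ, (T ^ k) v = c ^ k • v
  | 0 => by simp
  | k + 1 => by
    rw [pow_succ', mul_apply_eq_comp, pow_apply_of_apply_eq_smul T hv k, map_smul, hv,
      smul_smul, pow_succ, mul_comm]

/-- **Jensen / power-mean inequality for a positive symmetric operator** on a finite-dimensional
space: `(Re ⟪Φ, T Φ⟫)^k ≤ Re ⟪Φ, T^k Φ⟫` for `‖Φ‖ = 1` (spectral decomposition `Φ = Σ c_i e_i`,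
`T e_i = λ_i e_i`, `λ_i ≥ 0`, weights `|c_i|²` summing to one, and convexity of `t ↦ t^k`).
This is the Hölder/Jensen step of KT93 Lemma 7.4 / proof of Thm 6.1 ("the final bound follows from
the Hölder inequality"). [cite: KomaTasaki1993, Lemma 7.4 (7.15)–(7.17)] -/
theorem pow_re_inner_le_re_inner_pow [FiniteDimensional ℂ E] (T : E →L[ℂ] E)
    (hT : (T : E →ₗ[ℂ] E).IsSymmetric) (hpos : ∀ x : E, 0 ≤ (⟪x, T x⟫_ℂ).re)
    {Φ : E} (hΦ : ‖Φ‖ = 1) (k : ℕ) :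
    (⟪Φ, T Φ⟫_ℂ).re ^ k ≤ (⟪Φ, (T ^ k) Φ⟫_ℂ).re := by
  set n := Module.finrank ℂ E with hn
  let b : OrthonormalBasis (Fin n) ℂ E := hT.eigenvectorBasis hn.symm
  let ev : Fin n → ℝ := hT.eigenvalues hn.symm
  have hb : ∀ i, T (b i) = (ev i : ℂ) • b i := fun i => hT.apply_eigenvectorBasis hn.symm i
  have hbk : ∀ (j : ℕ) (i : Fin n), (T ^ j) (b i) = ((ev i : ℂ) ^ j) • b i :=
    fun j i => pow_apply_of_apply_eq_smul T (hb i) j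
  have hnorm : ∀ i, ‖b i‖ = 1 := fun i => b.orthonormal.1 i
  -- eigenvalues are nonnegative
  have hev : ∀ i, 0 ≤ ev i := fun i => by
    have h := hpos (b i)
    rw [hb i, inner_smul_right, inner_self_eq_norm_sq_to_K, hnorm i] at h
    simpa using h
  -- the weights
  let w : Fin n → ℝ := fun i => ‖⟪b i, Φ⟫_ℂ‖ ^ 2
  have hw0 : ∀ i, 0 ≤ w i := fun i => by positivity
  have hww : ∀ i, ⟪Φ, b i⟫_ℂ * ⟪b i, Φ⟫_ℂ = (w i : ℂ) := fun i => by
    rw [← inner_conj_symm Φ (b i), ← Complex.normSq_eq_conj_mul_self, Complex.normSq_eq_norm_sq]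
  have hw1 : ∑ i, w i = 1 := by
    have h := b.sum_inner_mul_inner Φ Φ
    simp_rw [hww] at h
    rw [inner_self_eq_norm_sq_to_K, hΦ] at h
    norm_num at h
    exact_mod_cast h
  -- moments
  have hmom : ∀ j : ℕ, (⟪Φ, (T ^ j) Φ⟫_ℂ).re = ∑ i, w i * ev i ^ j := fun j => by
    have h1 : ⟪Φ, (T ^ j) Φ⟫_ℂ = ∑ i, ⟪Φ, b i⟫_ℂ * ⟪b i, (T ^ j) Φ⟫_ℂ :=
      (b.sum_inner_mul_inner Φ ((T ^ j) Φ)).symm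
    have h2 : ∀ i, ⟪b i, (T ^ j) Φ⟫_ℂ = ((ev i : ℂ) ^ j) * ⟪b i, Φ⟫_ℂ := fun i => by
      rw [← inner_pow_apply_left_of_isSymmetric T hT j, hbk, inner_smul_left, map_pow,
        Complex.conj_ofReal]
    simp_rw [h1, h2, Complex.re_sum]
    refine Finset.sum_congr rfl fun i _ => ?_
    rw [mul_left_comm, hww]
    norm_cast
    ring
  calc (⟪Φ, T Φ⟫_ℂ).re ^ k = (∑ i, w i * ev i) ^ k := by
        rw [← pow_one T, hmom 1]; simp
    _ ≤ ∑ i, w i * ev i ^ k :=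
        Real.pow_arith_mean_le_arith_mean_pow univ w ev (fun i _ => hw0 i) hw1 (fun i _ => hev i) k
    _ = (⟪Φ, (T ^ k) Φ⟫_ℂ).re := (hmom k).symm

/-- `|Re ⟪Φ, D Φ⟫| ≤ ‖D‖` for a unit vector, in the form `Re ⟪Φ, P Φ⟫ ≥ Re ⟪Φ, Q Φ⟫ - ‖P - Q‖`.
[folklore] -/
private theorem re_inner_ge_sub_norm (P Q : E →L[ℂ] E) {Φ : E} (hΦ : ‖Φ‖ = 1) :
    (⟪Φ, Q Φ⟫_ℂ).re - ‖P - Q‖ ≤ (⟪Φ, P Φ⟫_ℂ).re := by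
  have h : (⟪Φ, P Φ⟫_ℂ).re = (⟪Φ, Q Φ⟫_ℂ).re + (⟪Φ, (P - Q) Φ⟫_ℂ).re := by
    rw [sub_apply, inner_sub_right, Complex.sub_re]; ring
  have hb : |(⟪Φ, (P - Q) Φ⟫_ℂ).re| ≤ ‖P - Q‖ :=
    calc |(⟪Φ, (P - Q) Φ⟫_ℂ).re| ≤ ‖⟪Φ, (P - Q) Φ⟫_ℂ‖ := Complex.abs_re_le_norm _
      _ ≤ ‖Φ‖ * ‖(P - Q) Φ‖ := norm_inner_le_norm _ _
      _ ≤ ‖Φ‖ * (‖P - Q‖ * ‖Φ‖) := by gcongr; exact (P - Q).le_opNorm Φ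
      _ = ‖P - Q‖ := by rw [hΦ]; ring
  rw [h]
  linarith [(abs_le.mp hb).1]

/-- `[A, B²] = [A, B] B + B [A, B]`, as a norm bound. [folklore] -/
private theorem norm_comm_mul_self_le (A B : E →L[ℂ] E) :
    ‖A * (B * B) - B * B * A‖ ≤ 2 * ‖A * B - B * A‖ * ‖B‖ := by
  have h : A * (B * B) - B * B * A = (A * B - B * A) * B + B * (A * B - B * A) := by noncomm_ring
  rw [h]
  calc _ ≤ ‖(A * B - B * A) * B‖ + ‖B * (A * B - B * A)‖ := norm_add_le _ _
    _ ≤ ‖A * B - B * A‖ * ‖B‖ + ‖B‖ * ‖A * B - B * A‖ :=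
        add_le_add (norm_mul_le _ _) (norm_mul_le _ _)
    _ = 2 * ‖A * B - B * A‖ * ‖B‖ := by ring

/-- Telescoping product of ratios. [folklore] -/
private theorem prod_range_div_eq (a : ℕ → ℝ) (k : ℕ) (ha : ∀ j, j ≤ k → a j ≠ 0) :
    ∏ j ∈ range k, a (j + 1) / a j = a k / a 0 := by
  induction k with
  | zero => simp [div_self (ha 0 le_rfl)]
  | succ k ih =>
    rw [prod_range_succ, ih fun j hj => ha j (by omega)]
    have hk : a k ≠ 0 := ha k (by omega)
    have h0 : a 0 ≠ 0 := ha 0 (by omega)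
    field_simp

/-- **AM–GM with telescoping** (KT93 (7.25)): for positive `a_0, …, a_k`, `b_0, …, b_k` with
`a_0 = b_0 = 1`, `a_k b_k ≤ ( (Σ_{j<k} (a_{j+1}/a_j + b_{j+1}/b_j)) / (2k) )^{2k}`.
[cite: KomaTasaki1993, (7.25)] -/
theorem mul_le_pow_sum_div (a b : ℕ → ℝ) (k : ℕ) (hk : k ≠ 0) (ha : ∀ j, j ≤ k → 0 < a j)
    (hb : ∀ j, j ≤ k → 0 < b j) (ha0 : a 0 = 1) (hb0 : b 0 = 1) :
    a k * b k ≤ ((∑ j ∈ range k, (a (j + 1) / a j + b (j + 1) / b j)) / (2 * k)) ^ (2 * k) := by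
  -- the `2k` ratios as one family on `range (2k)`
  let z : ℕ → ℝ := fun j => if j < k then a (j + 1) / a j else b (j - k + 1) / b (j - k)
  have hz_lo : ∀ j, j < k → z j = a (j + 1) / a j := fun j hj => by simp [z, hj]
  have hz_hi : ∀ j, z (k + j) = b (j + 1) / b j := fun j => by
    simp [z]
  have hzpos : ∀ j ∈ range (2 * k), 0 < z j := by
    intro j hj
    rw [Finset.mem_range] at hj
    by_cases hjk : j < k
    · rw [hz_lo j hjk]; exact div_pos (ha _ (by omega)) (ha _ (by omega))
    · obtain ⟨i, rfl⟩ : ∃ i, j = k + i := ⟨j - k, by omega⟩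
      rw [hz_hi]; exact div_pos (hb _ (by omega)) (hb _ (by omega))
  have hsum : ∑ j ∈ range (2 * k), z j = ∑ j ∈ range k, (a (j + 1) / a j + b (j + 1) / b j) := by
    rw [two_mul, sum_range_add, sum_add_distrib]
    congr 1
    · exact Finset.sum_congr rfl fun j hj => hz_lo j (Finset.mem_range.mp hj)
    · exact Finset.sum_congr rfl fun j _ => hz_hi j
  have hprod : ∏ j ∈ range (2 * k), z j = a k * b k := by
    rw [two_mul, prod_range_add]
    have h1 : ∏ j ∈ range k, z j = a k / a 0 := by
      rw [← prod_range_div_eq a k fun j hj => (ha j hj).ne']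
      exact Finset.prod_congr rfl fun j hj => hz_lo j (Finset.mem_range.mp hj)
    have h2 : ∏ j ∈ range k, z (k + j) = b k / b 0 := by
      rw [← prod_range_div_eq b k fun j hj => (hb j hj).ne']
      exact Finset.prod_congr rfl fun j _ => hz_hi j
    rw [h1, h2, ha0, hb0, div_one, div_one]
  -- AM–GM with equal weights `1/(2k)`
  have hk2 : (0 : ℝ) < 2 * k := by positivity
  have hcard : ((range (2 * k)).card : ℝ) = 2 * k := by simp
  have hw1 : ∑ _j ∈ range (2 * k), (1 / (2 * k) : ℝ) = 1 := by
    rw [sum_const, nsmul_eq_mul, hcard]; field_simp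
  have hamgm := Real.geom_mean_le_arith_mean_weighted (range (2 * k)) (fun _ => (1 / (2 * k) : ℝ)) z
    (fun _ _ => by positivity) hw1 (fun j hj => (hzpos j hj).le)
  -- `∏ z_j^{1/(2k)} = (∏ z_j)^{1/(2k)}`
  rw [Real.finsetProd_rpow _ _ (fun j hj => (hzpos j hj).le), hprod, ← Finset.mul_sum, hsum]
    at hamgm
  have hab : 0 ≤ a k * b k := (mul_pos (ha k le_rfl) (hb k le_rfl)).le
  have hmean : 0 ≤ 1 / (2 * k) * ∑ j ∈ range k, (a (j + 1) / a j + b (j + 1) / b j) :=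
    (Real.rpow_nonneg hab _).trans hamgm
  calc a k * b k = ((a k * b k) ^ (1 / (2 * k) : ℝ)) ^ (2 * k) := by
        rw [one_div, show (2 * k : ℝ) = ((2 * k : ℕ) : ℝ) by push_cast; ring,
          Real.rpow_inv_natCast_pow hab (by omega)]
    _ ≤ (1 / (2 * k) * ∑ j ∈ range k, (a (j + 1) / a j + b (j + 1) / b j)) ^ (2 * k) :=
        pow_le_pow_left₀ (Real.rpow_nonneg hab _) hamgm _
    _ = _ := by rw [one_div, inv_mul_eq_div]

end Generic

/-! ### Norm and commutator bounds for the order operators of a `U(1)` system -/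

namespace U1System

variable {Λ : Type u} [Fintype Λ] {E : Type v} [NormedAddCommGroup E] [InnerProductSpace ℂ E]
  (sys : U1System Λ E)

/-- `‖O^-‖ ≤ 2 o N`. [cite: KomaTasaki1994, (2.15), §2.3 iii)] -/
theorem norm_orderMinus_le : ‖sys.orderMinus‖ ≤ 2 * sys.obar * Fintype.card Λ := by
  have h0 := sys.norm_order_le 0
  have h1 := sys.norm_order_le 1
  calc ‖sys.orderMinus‖ ≤ ‖sys.order 0‖ + ‖I • sys.order 1‖ := norm_sub_le _ _
    _ = ‖sys.order 0‖ + ‖sys.order 1‖ := by rw [norm_smul, Complex.norm_I, one_mul]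
    _ ≤ 2 * sys.obar * Fintype.card Λ := by linarith

/-- The commutator `K_Λ = [O^{(1)}_Λ, O^{(2)}_Λ]`. [cite: KomaTasaki1993, Lemma 6.3 / (7.22)] -/
def orderComm : E →L[ℂ] E := sys.order 0 * sys.order 1 - sys.order 1 * sys.order 0

/-- `‖[O^{(1)}, O^{(2)}]‖ ≤ 2 o² N` (by i) only the diagonal terms `[o^{(1)}_x, o^{(2)}_x]` survive;
`KomaTasakiSSBProofs.norm_comm_order_le`). [cite: KomaTasaki1993, proof of Lemma 6.3]
[cite: KomaTasaki1994, §4] -/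
theorem norm_orderComm_le : ‖sys.orderComm‖ ≤ 2 * sys.obar ^ 2 * Fintype.card Λ :=
  sys.norm_comm_order_le

/-- `Q_Λ := (O^{(1)}_Λ)² + (O^{(2)}_Λ)²` (the `U(1)` Casimir of the order operators; KT93 (6.11)
with two components). [cite: KomaTasaki1993, (6.11) and Remark after Thm 6.1 (`SO(2)` case)] -/
def orderSq : E →L[ℂ] E := sys.order 0 * sys.order 0 + sys.order 1 * sys.order 1

/-- `O^- O^+ = Q + i [O^{(1)}, O^{(2)}]`. [cite: KomaTasaki1993, (7.13)–(7.14), (7.20)] -/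
theorem orderMinus_mul_orderPlus :
    sys.orderMinus * sys.orderPlus = sys.orderSq + I • sys.orderComm := by
  simp only [orderMinus, orderPlus, orderSq, orderComm, sub_mul, mul_add, smul_mul_assoc,
    mul_smul_comm, smul_sub, smul_smul, Complex.I_mul_I, neg_smul, one_smul]
  abel

/-- `O^+ O^- = Q - i [O^{(1)}, O^{(2)}]`. [cite: KomaTasaki1993, (7.13)–(7.14), (7.20)] -/
theorem orderPlus_mul_orderMinus :
    sys.orderPlus * sys.orderMinus = sys.orderSq - I • sys.orderComm := by
  simp only [orderMinus, orderPlus, orderSq, orderComm, add_mul, mul_sub, smul_mul_assoc,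
    mul_smul_comm, smul_add, smul_sub, smul_smul, Complex.I_mul_I, neg_smul, one_smul]
  abel

/-- `‖Q‖ ≤ 2 (o N)² ≤ (2 o N)²`. [cite: KomaTasaki1994, §2.3 iii)] -/
theorem norm_orderSq_le : ‖sys.orderSq‖ ≤ (2 * sys.obar * Fintype.card Λ) ^ 2 := by
  have h0 := sys.norm_order_le 0
  have h1 := sys.norm_order_le 1
  have hoN : 0 ≤ sys.obar * Fintype.card Λ := mul_nonneg sys.obar_pos.le (Nat.cast_nonneg _)
  calc ‖sys.orderSq‖ ≤ ‖sys.order 0 * sys.order 0‖ + ‖sys.order 1 * sys.order 1‖ := norm_add_le _ _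
    _ ≤ ‖sys.order 0‖ * ‖sys.order 0‖ + ‖sys.order 1‖ * ‖sys.order 1‖ :=
        add_le_add (norm_mul_le _ _) (norm_mul_le _ _)
    _ ≤ (sys.obar * Fintype.card Λ) * (sys.obar * Fintype.card Λ)
        + (sys.obar * Fintype.card Λ) * (sys.obar * Fintype.card Λ) :=
        add_le_add (mul_le_mul h0 h0 (norm_nonneg _) hoN) (mul_le_mul h1 h1 (norm_nonneg _) hoN)
    _ ≤ (2 * sys.obar * Fintype.card Λ) ^ 2 := by nlinarith [mul_nonneg hoN hoN]

/-- `[O^-, O^{(1)}] = i [O^{(1)}, O^{(2)}]`. [cite: KomaTasaki1993, (7.13)–(7.14)] -/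
theorem orderMinus_comm_order_zero :
    sys.orderMinus * sys.order 0 - sys.order 0 * sys.orderMinus = I • sys.orderComm := by
  simp only [orderMinus, orderComm, sub_mul, mul_sub, smul_mul_assoc, mul_smul_comm, smul_sub]
  abel

/-- `[O^-, O^{(2)}] = [O^{(1)}, O^{(2)}]`. [cite: KomaTasaki1993, (7.13)–(7.14)] -/
theorem orderMinus_comm_order_one :
    sys.orderMinus * sys.order 1 - sys.order 1 * sys.orderMinus = sys.orderComm := by
  simp only [orderMinus, orderComm, sub_mul, mul_sub, smul_mul_assoc, mul_smul_comm]
  abel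

/-- `[O^+, O^{(1)}] = -i [O^{(1)}, O^{(2)}]`. [cite: KomaTasaki1993, (7.13)–(7.14)] -/
theorem orderPlus_comm_order_zero :
    sys.orderPlus * sys.order 0 - sys.order 0 * sys.orderPlus = -(I • sys.orderComm) := by
  simp only [orderPlus, orderComm, add_mul, mul_add, smul_mul_assoc, mul_smul_comm, smul_sub]
  abel

/-- `[O^+, O^{(2)}] = [O^{(1)}, O^{(2)}]`. [cite: KomaTasaki1993, (7.13)–(7.14)] -/
theorem orderPlus_comm_order_one :
    sys.orderPlus * sys.order 1 - sys.order 1 * sys.orderPlus = sys.orderComm := by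
  simp only [orderPlus, orderComm, add_mul, mul_add, smul_mul_assoc, mul_smul_comm]
  abel

/-- `‖[A, Q]‖ ≤ 8 o³ N² = 2 o (2 o N)²` whenever
`‖[A, O^{(1)}]‖, ‖[A, O^{(2)}]‖ ≤ ‖[O^{(1)}, O^{(2)}]‖` (used for `A = O^±`).
[cite: KomaTasaki1993, Lemma 6.3 (6.10) / (7.21)–(7.22)] -/
theorem norm_comm_orderSq_le (A : E →L[ℂ] E)
    (hA0 : ‖A * sys.order 0 - sys.order 0 * A‖ ≤ ‖sys.orderComm‖)
    (hA1 : ‖A * sys.order 1 - sys.order 1 * A‖ ≤ ‖sys.orderComm‖) :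
    ‖A * sys.orderSq - sys.orderSq * A‖ ≤ 2 * sys.obar * (2 * sys.obar * Fintype.card Λ) ^ 2 := by
  have h0 := sys.norm_order_le 0
  have h1 := sys.norm_order_le 1
  have hK := sys.norm_orderComm_le
  have hoN : 0 ≤ sys.obar * Fintype.card Λ := mul_nonneg sys.obar_pos.le (Nat.cast_nonneg _)
  have hsplit : A * sys.orderSq - sys.orderSq * A =
      (A * (sys.order 0 * sys.order 0) - sys.order 0 * sys.order 0 * A)
        + (A * (sys.order 1 * sys.order 1) - sys.order 1 * sys.order 1 * A) := by
    simp only [orderSq, mul_add, add_mul]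
    abel
  rw [hsplit]
  calc _ ≤ ‖A * (sys.order 0 * sys.order 0) - sys.order 0 * sys.order 0 * A‖
        + ‖A * (sys.order 1 * sys.order 1) - sys.order 1 * sys.order 1 * A‖ := norm_add_le _ _
    _ ≤ 2 * ‖A * sys.order 0 - sys.order 0 * A‖ * ‖sys.order 0‖
        + 2 * ‖A * sys.order 1 - sys.order 1 * A‖ * ‖sys.order 1‖ :=
          add_le_add (norm_comm_mul_self_le _ _) (norm_comm_mul_self_le _ _)
    _ ≤ 2 * ‖sys.orderComm‖ * (sys.obar * Fintype.card Λ)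
        + 2 * ‖sys.orderComm‖ * (sys.obar * Fintype.card Λ) := by
          gcongr
    _ ≤ 2 * (2 * sys.obar ^ 2 * Fintype.card Λ) * (sys.obar * Fintype.card Λ)
        + 2 * (2 * sys.obar ^ 2 * Fintype.card Λ) * (sys.obar * Fintype.card Λ) := by
          gcongr
    _ = 2 * sys.obar * (2 * sys.obar * Fintype.card Λ) ^ 2 := by ring

/-- `‖[O^-, Q]‖ ≤ 2 o (2 o N)²`. [cite: KomaTasaki1993, (7.21)–(7.22)] -/
theorem norm_orderMinus_comm_orderSq_le :
    ‖sys.orderMinus * sys.orderSq - sys.orderSq * sys.orderMinus‖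
      ≤ 2 * sys.obar * (2 * sys.obar * Fintype.card Λ) ^ 2 := by
  refine sys.norm_comm_orderSq_le _ ?_ ?_
  · rw [orderMinus_comm_order_zero, norm_smul, Complex.norm_I, one_mul]
  · rw [orderMinus_comm_order_one]

/-- `‖[O^+, Q]‖ ≤ 2 o (2 o N)²`. [cite: KomaTasaki1993, (7.21)–(7.22)] -/
theorem norm_orderPlus_comm_orderSq_le :
    ‖sys.orderPlus * sys.orderSq - sys.orderSq * sys.orderPlus‖
      ≤ 2 * sys.obar * (2 * sys.obar * Fintype.card Λ) ^ 2 := by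
  refine sys.norm_comm_orderSq_le _ ?_ ?_
  · rw [orderPlus_comm_order_zero, norm_neg, norm_smul, Complex.norm_I, one_mul]
  · rw [orderPlus_comm_order_one]

/-- `(O^+)^*= O^-` on powers: `⟪(O^+)^j x, y⟫ = ⟪x, (O^-)^j y⟫`. [cite: KomaTasaki1994, (2.15)] -/
theorem inner_orderPlus_pow_left (j : ℕ) (x y : E) :
    ⟪(sys.orderPlus ^ j) x, y⟫_ℂ = ⟪x, (sys.orderMinus ^ j) y⟫_ℂ := by
  induction j generalizing x y with
  | zero => simp
  | succ j ih =>
    rw [pow_succ, mul_apply_eq_comp, ih, sys.inner_orderPlus_left, ← mul_apply_eq_comp,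
      ← pow_succ']

/-- `(O^-)^* = O^+` on powers: `⟪(O^-)^j x, y⟫ = ⟪x, (O^+)^j y⟫`. [cite: KomaTasaki1994, (2.15)] -/
theorem inner_orderMinus_pow_left (j : ℕ) (x y : E) :
    ⟪(sys.orderMinus ^ j) x, y⟫_ℂ = ⟪x, (sys.orderPlus ^ j) y⟫_ℂ := by
  induction j generalizing x y with
  | zero => simp
  | succ j ih =>
    rw [pow_succ, mul_apply_eq_comp, ih, sys.inner_orderMinus_left, ← mul_apply_eq_comp,
      ← pow_succ']

/-- `Q` is symmetric. [cite: KomaTasaki1994, §2.3] -/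
theorem isSymmetric_orderSq : (sys.orderSq : E →ₗ[ℂ] E).IsSymmetric := by
  have e0 : ∀ a b : E, ⟪sys.order 0 a, b⟫_ℂ = ⟪a, sys.order 0 b⟫_ℂ :=
    fun a b => sys.isSymmetric_order 0 a b
  have e1 : ∀ a b : E, ⟪sys.order 1 a, b⟫_ℂ = ⟪a, sys.order 1 b⟫_ℂ :=
    fun a b => sys.isSymmetric_order 1 a b
  intro x y
  change ⟪sys.orderSq x, y⟫_ℂ = ⟪x, sys.orderSq y⟫_ℂ
  simp only [orderSq, add_apply, mul_apply_eq_comp, inner_add_left,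
    inner_add_right]
  rw [e0, e0, e1, e1]

/-- `Re ⟪x, Q x⟫ = ‖O^{(1)} x‖² + ‖O^{(2)} x‖² ≥ 0`. [cite: KomaTasaki1994, §2.3] -/
theorem re_inner_orderSq (x : E) :
    (⟪x, sys.orderSq x⟫_ℂ).re = ‖sys.order 0 x‖ ^ 2 + ‖sys.order 1 x‖ ^ 2 := by
  have e0 : ⟪x, sys.order 0 (sys.order 0 x)⟫_ℂ = ⟪sys.order 0 x, sys.order 0 x⟫_ℂ :=
    (sys.isSymmetric_order 0 x (sys.order 0 x)).symm
  have e1 : ⟪x, sys.order 1 (sys.order 1 x)⟫_ℂ = ⟪sys.order 1 x, sys.order 1 x⟫_ℂ :=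
    (sys.isSymmetric_order 1 x (sys.order 1 x)).symm
  simp only [orderSq, add_apply, mul_apply_eq_comp, inner_add_right,
    Complex.add_re]
  rw [e0, e1, inner_self_eq_norm_sq_to_K, inner_self_eq_norm_sq_to_K]
  norm_cast

/-- (2.17) doubled: `Re ⟪Φ, Q Φ⟫ = 2 ⟨Φ, (O^{(1)})² Φ⟩ ≥ 2 (μ o N)²`.
[cite: KomaTasaki1994, §2.3 iv) (2.17)] -/
theorem re_inner_orderSq_ge {Φ : E} {EΛ μ : ℝ} (hΦ : IsLROEigenstate sys Φ EΛ μ) :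
    2 * (μ * sys.obar * Fintype.card Λ) ^ 2 ≤ (⟪Φ, sys.orderSq Φ⟫_ℂ).re := by
  have h := hΦ.lro
  simp only [orderSq, add_apply, mul_apply_eq_comp, inner_add_right,
    Complex.add_re]
  rw [← hΦ.lro_eq]
  linarith

/-! ### KT93 Lemma 7.4–7.5 / (7.26): `‖(O^±)^k Φ‖² ≥ (2μ²o²N²)^k - k² o (2oN)^{2k-1}` -/

/-- **Lower bound on `‖(O^+)^{k+1} Φ‖²`** (KT93 (7.15), (7.18) combined, `U(1)` constant):
`‖(O^+)^{k+1} Φ‖² = ⟨Φ, (O^-)^{k+1}(O^+)^{k+1} Φ⟩ ≥ ⟨Φ, Q^{k+1} Φ⟩ - (k+1)² o (2oN)^{2k+1}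
≥ (2 μ² o² N²)^{k+1} - (k+1)² o (2oN)^{2k+1}`.
[cite: KomaTasaki1993, Lemma 7.4 (7.15), Lemma 7.5 (7.18), (7.26)] -/
theorem norm_sq_orderPlus_pow_ge [FiniteDimensional ℂ E] {Φ : E} {EΛ μ : ℝ}
    (hΦ : IsLROEigenstate sys Φ EΛ μ) (k : ℕ) :
    (2 * (μ * sys.obar * Fintype.card Λ) ^ 2) ^ (k + 1)
        - ((k : ℝ) + 1) ^ 2 * sys.obar * (2 * sys.obar * Fintype.card Λ) ^ (2 * k + 1)
      ≤ ‖(sys.orderPlus ^ (k + 1)) Φ‖ ^ 2 := by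
  have hα : 0 ≤ 2 * sys.obar * Fintype.card Λ := by
    have := sys.obar_pos.le; positivity
  have h1 : ‖(sys.orderPlus ^ (k + 1)) Φ‖ ^ 2 =
      (⟪Φ, (sys.orderMinus ^ (k + 1) * sys.orderPlus ^ (k + 1)) Φ⟫_ℂ).re := by
    rw [mul_apply_eq_comp, ← sys.inner_orderPlus_pow_left, inner_self_eq_norm_sq_to_K]
    norm_cast
  have hAB : ‖sys.orderMinus * sys.orderPlus - sys.orderSq‖
      ≤ sys.obar * (2 * sys.obar * Fintype.card Λ) := by
    rw [orderMinus_mul_orderPlus, add_sub_cancel_left, norm_smul, Complex.norm_I, one_mul]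
    calc ‖sys.orderComm‖ ≤ 2 * sys.obar ^ 2 * Fintype.card Λ := sys.norm_orderComm_le
      _ = sys.obar * (2 * sys.obar * Fintype.card Λ) := by ring
  have h2 := norm_pow_mul_pow_sub_pow_le sys.orderMinus sys.orderPlus sys.orderSq hα
    sys.obar_pos.le sys.norm_orderMinus_le sys.norm_orderPlus_le sys.norm_orderSq_le hAB
    sys.norm_orderMinus_comm_orderSq_le k
  have h3 : (2 * (μ * sys.obar * Fintype.card Λ) ^ 2) ^ (k + 1)
      ≤ (⟪Φ, (sys.orderSq ^ (k + 1)) Φ⟫_ℂ).re :=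
    (pow_le_pow_left₀ (by positivity) (sys.re_inner_orderSq_ge hΦ) _).trans
      (pow_re_inner_le_re_inner_pow sys.orderSq sys.isSymmetric_orderSq
        (fun x => by rw [re_inner_orderSq]; positivity) hΦ.norm_eq_one (k + 1))
  have h4 := re_inner_ge_sub_norm (sys.orderMinus ^ (k + 1) * sys.orderPlus ^ (k + 1))
    (sys.orderSq ^ (k + 1)) hΦ.norm_eq_one
  rw [h1]
  linarith

/-- **Lower bound on `‖(O^-)^{k+1} Φ‖²**, the mirror image ("the same inequality with `O^-` and
`O^+` interchanged is also valid", KT93 after (7.19)).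
[cite: KomaTasaki1993, Lemma 7.4 (7.15), Lemma 7.5 (7.18)–(7.19), (7.26)] -/
theorem norm_sq_orderMinus_pow_ge [FiniteDimensional ℂ E] {Φ : E} {EΛ μ : ℝ}
    (hΦ : IsLROEigenstate sys Φ EΛ μ) (k : ℕ) :
    (2 * (μ * sys.obar * Fintype.card Λ) ^ 2) ^ (k + 1)
        - ((k : ℝ) + 1) ^ 2 * sys.obar * (2 * sys.obar * Fintype.card Λ) ^ (2 * k + 1)
      ≤ ‖(sys.orderMinus ^ (k + 1)) Φ‖ ^ 2 := by
  have hα : 0 ≤ 2 * sys.obar * Fintype.card Λ := by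
    have := sys.obar_pos.le; positivity
  have h1 : ‖(sys.orderMinus ^ (k + 1)) Φ‖ ^ 2 =
      (⟪Φ, (sys.orderPlus ^ (k + 1) * sys.orderMinus ^ (k + 1)) Φ⟫_ℂ).re := by
    rw [mul_apply_eq_comp, ← sys.inner_orderMinus_pow_left, inner_self_eq_norm_sq_to_K]
    norm_cast
  have hAB : ‖sys.orderPlus * sys.orderMinus - sys.orderSq‖
      ≤ sys.obar * (2 * sys.obar * Fintype.card Λ) := by
    rw [orderPlus_mul_orderMinus, sub_sub_cancel_left, norm_neg, norm_smul, Complex.norm_I,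
      one_mul]
    calc ‖sys.orderComm‖ ≤ 2 * sys.obar ^ 2 * Fintype.card Λ := sys.norm_orderComm_le
      _ = sys.obar * (2 * sys.obar * Fintype.card Λ) := by ring
  have h2 := norm_pow_mul_pow_sub_pow_le sys.orderPlus sys.orderMinus sys.orderSq hα
    sys.obar_pos.le sys.norm_orderPlus_le sys.norm_orderMinus_le sys.norm_orderSq_le hAB
    sys.norm_orderPlus_comm_orderSq_le k
  have h3 : (2 * (μ * sys.obar * Fintype.card Λ) ^ 2) ^ (k + 1)
      ≤ (⟪Φ, (sys.orderSq ^ (k + 1)) Φ⟫_ℂ).re :=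
    (pow_le_pow_left₀ (by positivity) (sys.re_inner_orderSq_ge hΦ) _).trans
      (pow_re_inner_le_re_inner_pow sys.orderSq sys.isSymmetric_orderSq
        (fun x => by rw [re_inner_orderSq]; positivity) hΦ.norm_eq_one (k + 1))
  have h4 := re_inner_ge_sub_norm (sys.orderPlus ^ (k + 1) * sys.orderMinus ^ (k + 1))
    (sys.orderSq ^ (k + 1)) hΦ.norm_eq_one
  rw [h1]
  linarith

end U1System

/-! ### Bookkeeping lemmas for finite double sums -/

section Sums

variable {E : Type v} [NormedAddCommGroup E] [InnerProductSpace ℂ E]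

/-- `Σ_{M=1}^{k} f(M) = Σ_{j<k} f(j+1)`. [folklore] -/
private theorem sum_Icc_one_eq_sum_range {M : Type*} [AddCommMonoid M] (f : ℕ → M) (k : ℕ) :
    ∑ i ∈ Icc 1 k, f i = ∑ j ∈ range k, f (j + 1) := by
  induction k with
  | zero => simp
  | succ k ih => rw [Finset.sum_Icc_succ_top (by omega), ih, sum_range_succ]

/-- A double sum whose terms vanish unless `i = j + 1`. [folklore] -/
private theorem sum_sum_range_eq_of_succ_left (f : ℕ → ℕ → ℂ) (m n : ℕ)
    (hf : ∀ i j, i ≠ j + 1 → f i j = 0) :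
    ∑ i ∈ range m, ∑ j ∈ range n, f i j = ∑ j ∈ range n, if j + 1 < m then f (j + 1) j else 0 := by
  rw [Finset.sum_comm]
  refine Finset.sum_congr rfl fun j _ => ?_
  split_ifs with h
  · rw [Finset.sum_eq_single (j + 1) (fun i _ hi => hf i j hi)
      (fun h' => absurd (Finset.mem_range.mpr h) h')]
  · exact Finset.sum_eq_zero fun i hi => hf i j (by rintro rfl; exact h (Finset.mem_range.mp hi))

/-- A double sum whose terms vanish unless `j = i + 1`. [folklore] -/
private theorem sum_sum_range_eq_of_succ_right (f : ℕ → ℕ → ℂ) (m n : ℕ)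
    (hf : ∀ i j, j ≠ i + 1 → f i j = 0) :
    ∑ i ∈ range m, ∑ j ∈ range n, f i j = ∑ i ∈ range m, if i + 1 < n then f i (i + 1) else 0 := by
  refine Finset.sum_congr rfl fun i _ => ?_
  split_ifs with h
  · rw [Finset.sum_eq_single (i + 1) (fun j _ hj => hf i j hj)
      (fun h' => absurd (Finset.mem_range.mpr h) h')]
  · exact Finset.sum_eq_zero fun j hj => hf i j (by rintro rfl; exact h (Finset.mem_range.mp hj))

/-- A double sum whose only non-zero term is `(0, 0)`. [folklore] -/
private theorem sum_sum_range_eq_of_zero_zero (f : ℕ → ℕ → ℂ) (m n : ℕ)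
    (hf : ∀ i j, ¬ (i = 0 ∧ j = 0) → f i j = 0) :
    ∑ i ∈ range (m + 1), ∑ j ∈ range (n + 1), f i j = f 0 0 := by
  rw [Finset.sum_eq_single 0, Finset.sum_eq_single 0]
  · intro j _ hj
    exact hf 0 j (by omega)
  · intro h
    exact absurd (Finset.mem_range.mpr (Nat.succ_pos n)) h
  · intro i _ hi
    exact Finset.sum_eq_zero fun j _ => hf i j (by omega)
  · intro h
    exact absurd (Finset.mem_range.mpr (Nat.succ_pos m)) h

/-- Dropping the vacuous last term of a truncated sum. [folklore] -/
private theorem sum_range_succ_ite (g : ℕ → ℂ) (k : ℕ) :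
    ∑ j ∈ range (k + 1), (if j + 1 < k + 1 then g j else 0) = ∑ j ∈ range k, g j := by
  rw [Finset.sum_range_succ]
  simp only [add_lt_add_iff_right, lt_self_iff_false, if_false, add_zero]
  exact Finset.sum_congr rfl fun j hj => if_pos (Finset.mem_range.mp hj)

/-- Expanding `⟪Σ αᵢ uᵢ, T (Σ βⱼ vⱼ)⟫`. [folklore] -/
private theorem inner_sum_smul_apply_sum_smul (T : E →L[ℂ] E) (s t : Finset ℕ) (α β : ℕ → ℂ)
    (u v : ℕ → E) :
    ⟪∑ i ∈ s, α i • u i, T (∑ j ∈ t, β j • v j)⟫_ℂ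
      = ∑ i ∈ s, ∑ j ∈ t, conj (α i) * (β j * ⟪u i, T (v j)⟫_ℂ) := by
  rw [sum_inner]
  refine Finset.sum_congr rfl fun i _ => ?_
  rw [map_sum, inner_sum]
  refine Finset.sum_congr rfl fun j _ => ?_
  rw [map_smul, inner_smul_left, inner_smul_right]

/-- `conj` fixes inverses of real numbers. [folklore] -/
private theorem conj_ofReal_inv (x : ℝ) : conj ((x : ℂ)⁻¹) = (x : ℂ)⁻¹ := by
  rw [map_inv₀, Complex.conj_ofReal]

/-- `x⁻¹ (y⁻¹ x²) = x / y` (with the junk conventions `0⁻¹ = 0`, `x/0 = 0`). [folklore] -/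
private theorem ofReal_inv_mul_inv_mul_sq (x y : ℝ) :
    (x : ℂ)⁻¹ * ((y : ℂ)⁻¹ * (x : ℂ) ^ 2) = ((x / y : ℝ) : ℂ) := by
  rcases eq_or_ne x 0 with rfl | hx
  · simp
  rcases eq_or_ne y 0 with rfl | hy
  · simp
  have hx' : (x : ℂ) ≠ 0 := by exact_mod_cast hx
  have hy' : (y : ℂ) ≠ 0 := by exact_mod_cast hy
  push_cast
  field_simp

/-- `y⁻¹ (x⁻¹ x²) = x / y` (with the junk conventions `0⁻¹ = 0`, `x/0 = 0`). [folklore] -/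
private theorem ofReal_inv_mul_inv_mul_sq' (x y : ℝ) :
    (y : ℂ)⁻¹ * ((x : ℂ)⁻¹ * (x : ℂ) ^ 2) = ((x / y : ℝ) : ℂ) := by
  rw [← ofReal_inv_mul_inv_mul_sq x y]
  ring

end Sums

/-! ### Charge bookkeeping for the matrix elements of `O^+` (KT94, proof of Theorem 2.5) -/

namespace U1System

variable {Λ : Type u} [Fintype Λ] {E : Type v} [NormedAddCommGroup E] [InnerProductSpace ℂ E]
  (sys : U1System Λ E)

/-- `orderPow` at a natural number. [cite: KomaTasaki1994, (2.19)] -/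
theorem orderPow_natCast (j : ℕ) : sys.orderPow (j : ℤ) = sys.orderPlus ^ j := by
  rw [sys.orderPow_of_nonneg (by omega), Int.toNat_natCast]

/-- `orderPow` at minus a natural number. [cite: KomaTasaki1994, (2.19)] -/
theorem orderPow_neg_natCast (j : ℕ) : sys.orderPow (-(j : ℤ)) = sys.orderMinus ^ j := by
  rcases Nat.eq_zero_or_pos j with rfl | hj
  · simp [orderPow]
  · rw [sys.orderPow_of_neg (by omega), neg_neg, Int.toNat_natCast]

/-- `⟪(O^+)^i Φ, O^+ (O^+)^j Φ⟫ = 0` unless `i = j + 1` (charges `c + i ≠ c + j + 1`).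
[cite: KomaTasaki1994, (2.16), proof of Theorem 2.5] -/
theorem inner_plusPow_orderPlus_plusPow_of_ne {Φ : E} {c : ℂ} (hC : sys.C Φ = c • Φ)
    (hc : conj c = c) {i j : ℕ} (h : i ≠ j + 1) :
    ⟪(sys.orderPlus ^ i) Φ, sys.orderPlus ((sys.orderPlus ^ j) Φ)⟫_ℂ = 0 := by
  have hx := sys.C_orderPlus_pow_apply hC i
  have hy : sys.C (sys.orderPlus ((sys.orderPlus ^ j) Φ)) =
      (c + j + 1) • sys.orderPlus ((sys.orderPlus ^ j) Φ) :=
    sys.C_orderPlus_apply (sys.C_orderPlus_pow_apply hC j)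
  refine sys.inner_eq_zero_of_eigen_C hx hy ?_
  rw [map_add, hc, map_natCast]
  intro h'
  apply h
  exact_mod_cast (show (i : ℂ) = j + 1 by linear_combination h')

/-- `⟪(O^+)^{j+1} Φ, O^+ (O^+)^j Φ⟫ = ‖(O^+)^{j+1} Φ‖²`.
[cite: KomaTasaki1994, proof of Theorem 2.5] -/
theorem inner_plusPow_succ_orderPlus_plusPow (Φ : E) (j : ℕ) :
    ⟪(sys.orderPlus ^ (j + 1)) Φ, sys.orderPlus ((sys.orderPlus ^ j) Φ)⟫_ℂ
      = ((‖(sys.orderPlus ^ (j + 1)) Φ‖ : ℂ)) ^ 2 := by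
  rw [← mul_apply_eq_comp, ← pow_succ', inner_self_eq_norm_sq_to_K]
  rfl

/-- `⟪(O^-)^i Φ, O^+ (O^-)^j Φ⟫ = 0` unless `j = i + 1` (charges `c - i ≠ c - j + 1`).
[cite: KomaTasaki1994, (2.16), proof of Theorem 2.5] -/
theorem inner_minusPow_orderPlus_minusPow_of_ne {Φ : E} {c : ℂ} (hC : sys.C Φ = c • Φ)
    (hc : conj c = c) {i j : ℕ} (h : j ≠ i + 1) :
    ⟪(sys.orderMinus ^ i) Φ, sys.orderPlus ((sys.orderMinus ^ j) Φ)⟫_ℂ = 0 := by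
  have hx := sys.C_orderMinus_pow_apply hC i
  have hy : sys.C (sys.orderPlus ((sys.orderMinus ^ j) Φ)) =
      (c - j + 1) • sys.orderPlus ((sys.orderMinus ^ j) Φ) :=
    sys.C_orderPlus_apply (sys.C_orderMinus_pow_apply hC j)
  refine sys.inner_eq_zero_of_eigen_C hx hy ?_
  rw [map_sub, hc, map_natCast]
  intro h'
  apply h
  exact_mod_cast (show (j : ℂ) = i + 1 by linear_combination h')

/-- `⟪(O^-)^i Φ, O^+ (O^-)^{i+1} Φ⟫ = ‖(O^-)^{i+1} Φ‖²` (`(O^+)^* = O^-`).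
[cite: KomaTasaki1994, (2.15), proof of Theorem 2.5] -/
theorem inner_minusPow_orderPlus_minusPow_succ (Φ : E) (i : ℕ) :
    ⟪(sys.orderMinus ^ i) Φ, sys.orderPlus ((sys.orderMinus ^ (i + 1)) Φ)⟫_ℂ
      = ((‖(sys.orderMinus ^ (i + 1)) Φ‖ : ℂ)) ^ 2 := by
  rw [← sys.inner_orderMinus_left, ← mul_apply_eq_comp, ← pow_succ', inner_self_eq_norm_sq_to_K]
  rfl

/-- `⟪(O^+)^i Φ, O^+ (O^-)^{j+1} Φ⟫ = 0` unless `i = j = 0` (charges `c + i ≠ c - j`).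
[cite: KomaTasaki1994, (2.16), proof of Theorem 2.5] -/
theorem inner_plusPow_orderPlus_minusPow_of_ne {Φ : E} {c : ℂ} (hC : sys.C Φ = c • Φ)
    (hc : conj c = c) {i j : ℕ} (h : ¬ (i = 0 ∧ j = 0)) :
    ⟪(sys.orderPlus ^ i) Φ, sys.orderPlus ((sys.orderMinus ^ (j + 1)) Φ)⟫_ℂ = 0 := by
  have hx := sys.C_orderPlus_pow_apply hC i
  have hy : sys.C (sys.orderPlus ((sys.orderMinus ^ (j + 1)) Φ)) =
      (c - (j + 1 : ℕ) + 1) • sys.orderPlus ((sys.orderMinus ^ (j + 1)) Φ) :=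
    sys.C_orderPlus_apply (sys.C_orderMinus_pow_apply hC (j + 1))
  refine sys.inner_eq_zero_of_eigen_C hx hy ?_
  rw [map_add, hc, map_natCast]
  intro h'
  apply h
  have h2 : ((i + j : ℕ) : ℂ) = 0 := by push_cast at h' ⊢; linear_combination h'
  have h3 : i + j = 0 := by exact_mod_cast h2
  omega

/-- `⟪Φ, O^+ O^- Φ⟫ = ‖O^- Φ‖²`. [cite: KomaTasaki1994, (2.15), proof of Theorem 2.5] -/
theorem inner_orderPlus_orderMinus_self (Φ : E) :
    ⟪(sys.orderPlus ^ 0) Φ, sys.orderPlus ((sys.orderMinus ^ (0 + 1)) Φ)⟫_ℂ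
      = ((‖(sys.orderMinus ^ (0 + 1)) Φ‖ : ℂ)) ^ 2 := by
  rw [pow_zero, one_apply_eq_self, ← sys.inner_orderMinus_left, zero_add, pow_one,
    inner_self_eq_norm_sq_to_K]
  rfl

/-- `⟪(O^-)^{i+1} Φ, O^+ (O^+)^j Φ⟫ = 0` always (charges `c - i - 1 ≠ c + j + 1`).
[cite: KomaTasaki1994, (2.16), proof of Theorem 2.5] -/
theorem inner_minusPow_succ_orderPlus_plusPow {Φ : E} {c : ℂ} (hC : sys.C Φ = c • Φ)
    (hc : conj c = c) (i j : ℕ) :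
    ⟪(sys.orderMinus ^ (i + 1)) Φ, sys.orderPlus ((sys.orderPlus ^ j) Φ)⟫_ℂ = 0 := by
  have hx := sys.C_orderMinus_pow_apply hC (i + 1)
  have hy : sys.C (sys.orderPlus ((sys.orderPlus ^ j) Φ)) =
      (c + j + 1) • sys.orderPlus ((sys.orderPlus ^ j) Φ) :=
    sys.C_orderPlus_apply (sys.C_orderPlus_pow_apply hC j)
  refine sys.inner_eq_zero_of_eigen_C hx hy ?_
  rw [map_sub, hc, map_natCast]
  intro h'
  have h2 : ((i + 1 + j + 1 : ℕ) : ℂ) = 0 := by push_cast at h' ⊢; linear_combination -h'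
  have h3 : i + 1 + j + 1 = 0 := by exact_mod_cast h2
  omega

/-! ### The matrix element `(Ξ^{(k)}, O^+ Ξ^{(k)})` (KT94 proof of Thm 2.5, first display) -/

/-- The unnormalised symmetry-breaking vector `ξ^{(k)} = Φ + Σ_{M=1}^{k} (Ψ^{(M)} + Ψ^{(-M)})`,
so that `Ξ^{(k)} = (2k+1)^{-1/2} ξ^{(k)}` ((2.27)). [cite: KomaTasaki1994, (2.27)] -/
def xiVec (k : ℕ) (Φ : E) : E :=
  Φ + ∑ M ∈ Finset.Icc 1 k, (sys.trialState M Φ + sys.trialState (-(M : ℤ)) Φ)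

/-- `Ξ^{(k)} = (2k+1)^{-1/2} ξ^{(k)}`. [cite: KomaTasaki1994, (2.27)] -/
theorem xiState_eq_smul_xiVec (k : ℕ) (Φ : E) :
    sys.xiState k Φ = ((Real.sqrt (2 * k + 1))⁻¹ : ℂ) • sys.xiVec k Φ := rfl

/-- `ξ^{(k)}` split by the sign of the charge shift:
`ξ^{(k)} = Σ_{j=0}^{k} ‖(O^+)^j Φ‖⁻¹ (O^+)^j Φ + Σ_{j=0}^{k-1} ‖(O^-)^{j+1} Φ‖⁻¹ (O^-)^{j+1} Φ`
(for `‖Φ‖ = 1`). [cite: KomaTasaki1994, (2.19), (2.27)] -/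
theorem xiVec_eq_sum_add_sum (k : ℕ) {Φ : E} (hΦ : ‖Φ‖ = 1) :
    sys.xiVec k Φ =
      ∑ j ∈ range (k + 1), (‖(sys.orderPlus ^ j) Φ‖⁻¹ : ℂ) • (sys.orderPlus ^ j) Φ
        + ∑ j ∈ range k, (‖(sys.orderMinus ^ (j + 1)) Φ‖⁻¹ : ℂ) • (sys.orderMinus ^ (j + 1)) Φ := by
  have hP : ∀ j : ℕ, sys.trialState (j : ℤ) Φ
      = (‖(sys.orderPlus ^ j) Φ‖⁻¹ : ℂ) • (sys.orderPlus ^ j) Φ := fun j => by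
    rw [trialState, orderPow_natCast]
  have hM : ∀ j : ℕ, sys.trialState (-(j : ℤ)) Φ
      = (‖(sys.orderMinus ^ j) Φ‖⁻¹ : ℂ) • (sys.orderMinus ^ j) Φ := fun j => by
    rw [trialState, orderPow_neg_natCast]
  have h0 : (‖(sys.orderPlus ^ 0) Φ‖⁻¹ : ℂ) • (sys.orderPlus ^ 0) Φ = Φ := by
    simp [hΦ]
  have e1 : ∑ j ∈ range k, sys.trialState ((j + 1 : ℕ) : ℤ) Φ
      = ∑ j ∈ range k, (‖(sys.orderPlus ^ (j + 1)) Φ‖⁻¹ : ℂ) • (sys.orderPlus ^ (j + 1)) Φ :=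
    Finset.sum_congr rfl fun j _ => hP (j + 1)
  have e2 : ∑ j ∈ range k, sys.trialState (-((j + 1 : ℕ) : ℤ)) Φ
      = ∑ j ∈ range k, (‖(sys.orderMinus ^ (j + 1)) Φ‖⁻¹ : ℂ) • (sys.orderMinus ^ (j + 1)) Φ :=
    Finset.sum_congr rfl fun j _ => hM (j + 1)
  rw [xiVec, sum_Icc_one_eq_sum_range, sum_add_distrib, e1, e2, sum_range_succ' _ k, h0]
  abel

/-- Block `⟪P, O⁺ P⟫` of the matrix element, `P = Σ_{j≤k} ‖(O^+)^jΦ‖⁻¹ (O^+)^jΦ`.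
[cite: KomaTasaki1994, proof of Theorem 2.5] -/
theorem sum_plus_plus (k : ℕ) {Φ : E} {c : ℂ} (hC : sys.C Φ = c • Φ) (hc : conj c = c) :
    ∑ i ∈ range (k + 1 + 1), ∑ j ∈ range (k + 1 + 1),
      conj (‖(sys.orderPlus ^ i) Φ‖⁻¹ : ℂ) * ((‖(sys.orderPlus ^ j) Φ‖⁻¹ : ℂ)
        * ⟪(sys.orderPlus ^ i) Φ, sys.orderPlus ((sys.orderPlus ^ j) Φ)⟫_ℂ)
      = ∑ j ∈ range (k + 1),
        (((‖(sys.orderPlus ^ (j + 1)) Φ‖ / ‖(sys.orderPlus ^ j) Φ‖ : ℝ)) : ℂ) := by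
  rw [sum_sum_range_eq_of_succ_left _ _ _ (fun i j hij => by
    rw [sys.inner_plusPow_orderPlus_plusPow_of_ne hC hc hij, mul_zero, mul_zero]),
    sum_range_succ_ite]
  refine Finset.sum_congr rfl fun j _ => ?_
  rw [sys.inner_plusPow_succ_orderPlus_plusPow, conj_ofReal_inv, ofReal_inv_mul_inv_mul_sq]

/-- Block `⟪P, O⁺ M⟫`, `M = Σ_{j<k} ‖(O^-)^{j+1}Φ‖⁻¹ (O^-)^{j+1}Φ`: only `⟪Φ, O⁺ O⁻ Φ⟫` survives.
[cite: KomaTasaki1994, proof of Theorem 2.5] -/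
theorem sum_plus_minus (k : ℕ) {Φ : E} {c : ℂ} (hΦ : ‖Φ‖ = 1) (hC : sys.C Φ = c • Φ)
    (hc : conj c = c) :
    ∑ i ∈ range (k + 1 + 1), ∑ j ∈ range (k + 1),
      conj (‖(sys.orderPlus ^ i) Φ‖⁻¹ : ℂ) * ((‖(sys.orderMinus ^ (j + 1)) Φ‖⁻¹ : ℂ)
        * ⟪(sys.orderPlus ^ i) Φ, sys.orderPlus ((sys.orderMinus ^ (j + 1)) Φ)⟫_ℂ)
      = (((‖(sys.orderMinus ^ (0 + 1)) Φ‖ / ‖(sys.orderMinus ^ 0) Φ‖ : ℝ)) : ℂ) := by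
  rw [sum_sum_range_eq_of_zero_zero _ _ _ (fun i j hij => by
    rw [sys.inner_plusPow_orderPlus_minusPow_of_ne hC hc hij, mul_zero, mul_zero])]
  rw [sys.inner_orderPlus_orderMinus_self, conj_ofReal_inv, ofReal_inv_mul_inv_mul_sq']
  simp [hΦ]

/-- Block `⟪M, O⁺ P⟫`: vanishes identically. [cite: KomaTasaki1994, proof of Theorem 2.5] -/
theorem sum_minus_plus (k : ℕ) {Φ : E} {c : ℂ} (hC : sys.C Φ = c • Φ) (hc : conj c = c) :
    ∑ i ∈ range (k + 1), ∑ j ∈ range (k + 1 + 1),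
      conj (‖(sys.orderMinus ^ (i + 1)) Φ‖⁻¹ : ℂ) * ((‖(sys.orderPlus ^ j) Φ‖⁻¹ : ℂ)
        * ⟪(sys.orderMinus ^ (i + 1)) Φ, sys.orderPlus ((sys.orderPlus ^ j) Φ)⟫_ℂ) = 0 := by
  refine Finset.sum_eq_zero fun i _ => Finset.sum_eq_zero fun j _ => ?_
  rw [sys.inner_minusPow_succ_orderPlus_plusPow hC hc, mul_zero, mul_zero]

/-- Block `⟪M, O⁺ M⟫`. [cite: KomaTasaki1994, proof of Theorem 2.5] -/
theorem sum_minus_minus (k : ℕ) {Φ : E} {c : ℂ} (hC : sys.C Φ = c • Φ) (hc : conj c = c) :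
    ∑ i ∈ range (k + 1), ∑ j ∈ range (k + 1),
      conj (‖(sys.orderMinus ^ (i + 1)) Φ‖⁻¹ : ℂ) * ((‖(sys.orderMinus ^ (j + 1)) Φ‖⁻¹ : ℂ)
        * ⟪(sys.orderMinus ^ (i + 1)) Φ, sys.orderPlus ((sys.orderMinus ^ (j + 1)) Φ)⟫_ℂ)
      = ∑ i ∈ range k,
        (((‖(sys.orderMinus ^ (i + 1 + 1)) Φ‖ / ‖(sys.orderMinus ^ (i + 1)) Φ‖ : ℝ)) : ℂ) := by
  rw [sum_sum_range_eq_of_succ_right _ _ _ (fun i j hij => by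
    rw [sys.inner_minusPow_orderPlus_minusPow_of_ne hC hc (by omega), mul_zero, mul_zero]),
    sum_range_succ_ite]
  refine Finset.sum_congr rfl fun i _ => ?_
  rw [sys.inner_minusPow_orderPlus_minusPow_succ, conj_ofReal_inv, ofReal_inv_mul_inv_mul_sq']

/-- **The surviving matrix elements** (KT94 proof of Thm 2.5, first display; KT93 (7.25) l.h.s.):
for a normalised `C`-eigenvector `Φ`,
`(ξ^{(k)}, O^+ ξ^{(k)}) = Σ_{j<k} ( ‖(O^+)^{j+1}Φ‖/‖(O^+)^jΦ‖ + ‖(O^-)^{j+1}Φ‖/‖(O^-)^jΦ‖ )`.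
[cite: KomaTasaki1994, proof of Theorem 2.5] [cite: KomaTasaki1993, (7.25)] -/
theorem inner_xiVec_orderPlus (k : ℕ) {Φ : E} {c : ℂ} (hΦ : ‖Φ‖ = 1) (hC : sys.C Φ = c • Φ)
    (hc : conj c = c) :
    ⟪sys.xiVec k Φ, sys.orderPlus (sys.xiVec k Φ)⟫_ℂ =
      ((∑ j ∈ range k, (‖(sys.orderPlus ^ (j + 1)) Φ‖ / ‖(sys.orderPlus ^ j) Φ‖
        + ‖(sys.orderMinus ^ (j + 1)) Φ‖ / ‖(sys.orderMinus ^ j) Φ‖) : ℝ) : ℂ) := by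
  rcases Nat.eq_zero_or_pos k with rfl | hk
  · -- `k = 0`: `ξ = Φ` and `⟪Φ, O⁺ Φ⟫ = 0`
    have h0 : sys.xiVec 0 Φ = Φ := by simp [xiVec]
    rw [h0, inner_orderPlus_eq_zero sys hC]
    simp
  obtain ⟨k, rfl⟩ : ∃ k', k = k' + 1 := ⟨k - 1, by omega⟩
  rw [sys.xiVec_eq_sum_add_sum (k + 1) hΦ, map_add, inner_add_left, inner_add_right,
    inner_add_right, inner_sum_smul_apply_sum_smul, inner_sum_smul_apply_sum_smul,
    inner_sum_smul_apply_sum_smul, inner_sum_smul_apply_sum_smul, sys.sum_plus_plus k hC hc,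
    sys.sum_plus_minus k hΦ hC hc, sys.sum_minus_plus k hC hc, sys.sum_minus_minus k hC hc]
  have hreal : (∑ j ∈ range (k + 1), ‖(sys.orderPlus ^ (j + 1)) Φ‖ / ‖(sys.orderPlus ^ j) Φ‖)
      + ‖(sys.orderMinus ^ (0 + 1)) Φ‖ / ‖(sys.orderMinus ^ 0) Φ‖
      + (0 + ∑ i ∈ range k, ‖(sys.orderMinus ^ (i + 1 + 1)) Φ‖ / ‖(sys.orderMinus ^ (i + 1)) Φ‖)
      = ∑ j ∈ range (k + 1), (‖(sys.orderPlus ^ (j + 1)) Φ‖ / ‖(sys.orderPlus ^ j) Φ‖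
        + ‖(sys.orderMinus ^ (j + 1)) Φ‖ / ‖(sys.orderMinus ^ j) Φ‖) := by
    rw [sum_add_distrib, sum_range_succ' (fun j => ‖(sys.orderMinus ^ (j + 1)) Φ‖
      / ‖(sys.orderMinus ^ j) Φ‖) k]
    simp only [zero_add]
    ring
  exact_mod_cast hreal

/-- `Re ⟪ξ, O^+ ξ⟫ = Re ⟪ξ, O^{(1)} ξ⟫` for every vector (as `O^+ = O^{(1)} + i O^{(2)}` with
`⟪ξ, O^{(2)} ξ⟫` real). [cite: KomaTasaki1994, (2.15)] -/
theorem re_inner_orderPlus_eq (ξ : E) :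
    (⟪ξ, sys.orderPlus ξ⟫_ℂ).re = (⟪ξ, sys.order 0 ξ⟫_ℂ).re := by
  have hO2im : (⟪ξ, sys.order 1 ξ⟫_ℂ).im = 0 := by
    refine Complex.conj_eq_iff_im.mp ?_
    rw [inner_conj_symm]
    exact sys.isSymmetric_order 1 ξ ξ
  have hdecomp : ⟪ξ, sys.orderPlus ξ⟫_ℂ = ⟪ξ, sys.order 0 ξ⟫_ℂ + I * ⟪ξ, sys.order 1 ξ⟫_ℂ := by
    simp only [orderPlus, add_apply, smul_apply, inner_add_right,
      inner_smul_right]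
  rw [hdecomp, Complex.add_re, Complex.mul_re, Complex.I_re, Complex.I_im, hO2im]
  ring

/-- **`(2k+1) Re (Ξ^{(k)}, O^{(1)} Ξ^{(k)})`
`= Σ_{j<k} (‖(O^+)^{j+1}Φ‖/‖(O^+)^jΦ‖ + ‖(O^-)^{j+1}Φ‖/‖(O^-)^jΦ‖)`**
for a normalised `C`-eigenvector `Φ`. [cite: KomaTasaki1994, proof of Theorem 2.5]
[cite: KomaTasaki1993, (7.25)] -/
theorem re_inner_xiState_order_zero (k : ℕ) {Φ : E} {c : ℂ} (hΦ : ‖Φ‖ = 1) (hC : sys.C Φ = c • Φ)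
    (hc : conj c = c) :
    (2 * k + 1) * (⟪sys.xiState k Φ, sys.order 0 (sys.xiState k Φ)⟫_ℂ).re =
      ∑ j ∈ range k, (‖(sys.orderPlus ^ (j + 1)) Φ‖ / ‖(sys.orderPlus ^ j) Φ‖
        + ‖(sys.orderMinus ^ (j + 1)) Φ‖ / ‖(sys.orderMinus ^ j) Φ‖) := by
  rw [← sys.re_inner_orderPlus_eq, xiState_eq_smul_xiVec, map_smul, inner_smul_left,
    inner_smul_right, ← mul_assoc, sys.inner_xiVec_orderPlus k hΦ hC hc]
  have hs : (0 : ℝ) < 2 * k + 1 := by positivity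
  have hc' : (starRingEnd ℂ) ((Real.sqrt (2 * k + 1))⁻¹ : ℂ) * ((Real.sqrt (2 * k + 1))⁻¹ : ℂ)
      = (((2 * k + 1)⁻¹ : ℝ) : ℂ) := by
    rw [map_inv₀, Complex.conj_ofReal, ← mul_inv, ← Complex.ofReal_mul,
      Real.mul_self_sqrt hs.le]
    push_cast
    ring
  rw [hc', ← Complex.ofReal_mul, Complex.ofReal_re, ← mul_assoc, mul_inv_cancel₀ hs.ne', one_mul]

end U1System

/-! ### KT94 Theorem 2.5 (2.30): the finite-volume bound -/

namespace U1System

variable {Λ : Type u} [Fintype Λ] {E : Type v} [NormedAddCommGroup E] [InnerProductSpace ℂ E]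
  (sys : U1System Λ E)

/-- If `(O^+)^k Φ ≠ 0` then `(O^+)^j Φ ≠ 0` for `j ≤ k`. [folklore] -/
private theorem plusPow_apply_ne_zero_of_le {Φ : E} {k j : ℕ} (hk : (sys.orderPlus ^ k) Φ ≠ 0)
    (hj : j ≤ k) : (sys.orderPlus ^ j) Φ ≠ 0 := by
  obtain ⟨d, rfl⟩ : ∃ d, k = d + j := ⟨k - j, by omega⟩
  intro h
  apply hk
  rw [pow_add, mul_apply_eq_comp, h, map_zero]

/-- If `(O^-)^k Φ ≠ 0` then `(O^-)^j Φ ≠ 0` for `j ≤ k`. [folklore] -/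
private theorem minusPow_apply_ne_zero_of_le {Φ : E} {k j : ℕ} (hk : (sys.orderMinus ^ k) Φ ≠ 0)
    (hj : j ≤ k) : (sys.orderMinus ^ j) Φ ≠ 0 := by
  obtain ⟨d, rfl⟩ : ∃ d, k = d + j := ⟨k - j, by omega⟩
  intro h
  apply hk
  rw [pow_add, mul_apply_eq_comp, h, map_zero]

/-- **KT94 Theorem 2.5 (2.30), finite-volume quantitative form (`U(1)` case) — PROVED.**
For a `U(1)` system satisfying i), iii) and a state `Φ` with obscured symmetry breaking iv) (2.17),
for every `k ≥ 1` and every `N = |Λ|`, the symmetry-breaking trial state `Ξ^{(k)}` (2.27) has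
`Re (Ξ^{(k)}, O^{(1)} Ξ^{(k)}) ≥ 0` and

  `(2 (μ o N)²)^k - k² o (2 o N)^{2k-1} ≤ ( (2k+1)/(2k) · Re (Ξ^{(k)}, O^{(1)} Ξ^{(k)}) )^{2k}`,

i.e. `N⁻¹ (Ξ^{(k)}, O^{(1)} Ξ^{(k)}) ≥ (2k/(2k+1)) ((2μ²o²)^k - k² 2^{2k-1} o^{2k} N⁻¹)₊^{1/(2k)}`,
which tends to `(2k/(2k+1)) √2 μ o` as `N → ∞` and to `√2 μ o` as then `k → ∞` (KT (2.30); see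
`theorem_2_5_orderOne_holds`).  Proof = KT93 (7.25)–(7.26): charge bookkeeping
(`re_inner_xiState_order_zero`), AM–GM with telescoping (`mul_le_pow_sum_div`), and the moment
bounds `‖(O^±)^k Φ‖² ≥ (2μ²o²N²)^k - k² o (2oN)^{2k-1}` (`norm_sq_orderPlus_pow_ge`,
`norm_sq_orderMinus_pow_ge`).
[cite: KomaTasaki1994, Theorem 2.5 (2.30)] [cite: KomaTasaki1993, Theorem 7.3, (7.25)–(7.26)] -/
theorem theorem_2_5_orderOne_fin [FiniteDimensional ℂ E] {Φ : E} {EΛ μ : ℝ}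
    (hΦ : IsLROEigenstate sys Φ EΛ μ) (k : ℕ) (hk : 1 ≤ k) :
    0 ≤ (⟪sys.xiState k Φ, sys.order 0 (sys.xiState k Φ)⟫_ℂ).re ∧
      (2 * (μ * sys.obar * Fintype.card Λ) ^ 2) ^ k
          - (k : ℝ) ^ 2 * sys.obar * (2 * sys.obar * Fintype.card Λ) ^ (2 * k - 1)
        ≤ ((2 * k + 1) / (2 * k) * (⟪sys.xiState k Φ, sys.order 0 (sys.xiState k Φ)⟫_ℂ).re)
          ^ (2 * k) := by
  obtain ⟨c, hC⟩ := hΦ.eigen_C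
  have hΦne : Φ ≠ 0 := by
    intro h0
    have h1 := hΦ.norm_eq_one
    rw [h0, norm_zero] at h1
    exact zero_ne_one h1
  have hc : conj c = c := sys.conj_eq_of_eigen_C hΦne hC
  -- the sum of ratios `S`
  have hS := sys.re_inner_xiState_order_zero k hΦ.norm_eq_one hC hc
  have hS0 : 0 ≤ ∑ j ∈ range k, (‖(sys.orderPlus ^ (j + 1)) Φ‖ / ‖(sys.orderPlus ^ j) Φ‖
      + ‖(sys.orderMinus ^ (j + 1)) Φ‖ / ‖(sys.orderMinus ^ j) Φ‖) :=
    Finset.sum_nonneg fun j _ => add_nonneg (div_nonneg (norm_nonneg _) (norm_nonneg _))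
      (div_nonneg (norm_nonneg _) (norm_nonneg _))
  have hkpos : (0 : ℝ) < 2 * k + 1 := by positivity
  have hk2 : (0 : ℝ) < 2 * k := by
    have : (1 : ℝ) ≤ k := by exact_mod_cast hk
    linarith
  have hx0 : 0 ≤ (⟪sys.xiState k Φ, sys.order 0 (sys.xiState k Φ)⟫_ℂ).re := by
    by_contra hneg
    push Not at hneg
    have := mul_neg_of_pos_of_neg hkpos hneg
    linarith
  refine ⟨hx0, ?_⟩
  -- `(2k+1)/(2k) · x = S / (2k)`
  have hy : (2 * k + 1) / (2 * k) * (⟪sys.xiState k Φ, sys.order 0 (sys.xiState k Φ)⟫_ℂ).re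
      = (∑ j ∈ range k, (‖(sys.orderPlus ^ (j + 1)) Φ‖ / ‖(sys.orderPlus ^ j) Φ‖
          + ‖(sys.orderMinus ^ (j + 1)) Φ‖ / ‖(sys.orderMinus ^ j) Φ‖)) / (2 * k) := by
    rw [div_mul_eq_mul_div, hS]
  rw [hy]
  obtain ⟨k, rfl⟩ : ∃ k', k = k' + 1 := ⟨k - 1, by omega⟩
  have e1 : 2 * (k + 1) - 1 = 2 * k + 1 := by omega
  rw [e1]
  -- the lower bound `L`
  by_cases hL : (2 * (μ * sys.obar * Fintype.card Λ) ^ 2) ^ (k + 1)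
      - ((k + 1 : ℕ) : ℝ) ^ 2 * sys.obar * (2 * sys.obar * Fintype.card Λ) ^ (2 * k + 1) ≤ 0
  · exact hL.trans (pow_nonneg (div_nonneg hS0 hk2.le) _)
  push Not at hL
  have hL' : ((k + 1 : ℕ) : ℝ) ^ 2 = ((k : ℝ) + 1) ^ 2 := by push_cast; ring
  have ha2 := sys.norm_sq_orderPlus_pow_ge hΦ k
  have hb2 := sys.norm_sq_orderMinus_pow_ge hΦ k
  rw [← hL'] at ha2 hb2
  -- positivity of all the norms along both chains
  have hak : (sys.orderPlus ^ (k + 1)) Φ ≠ 0 := by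
    intro h0
    rw [h0, norm_zero] at ha2
    linarith
  have hbk : (sys.orderMinus ^ (k + 1)) Φ ≠ 0 := by
    intro h0
    rw [h0, norm_zero] at hb2
    linarith
  have ha : ∀ j, j ≤ k + 1 → 0 < ‖(sys.orderPlus ^ j) Φ‖ :=
    fun j hj => norm_pos_iff.mpr (sys.plusPow_apply_ne_zero_of_le hak hj)
  have hb : ∀ j, j ≤ k + 1 → 0 < ‖(sys.orderMinus ^ j) Φ‖ :=
    fun j hj => norm_pos_iff.mpr (sys.minusPow_apply_ne_zero_of_le hbk hj)
  -- AM–GM with telescoping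
  have hamgm := mul_le_pow_sum_div (fun j => ‖(sys.orderPlus ^ j) Φ‖)
    (fun j => ‖(sys.orderMinus ^ j) Φ‖) (k + 1) (by omega) ha hb
    (by simp [hΦ.norm_eq_one]) (by simp [hΦ.norm_eq_one])
  -- `L ≤ a_k b_k`
  have hsq : Real.sqrt ((2 * (μ * sys.obar * Fintype.card Λ) ^ 2) ^ (k + 1)
      - ((k + 1 : ℕ) : ℝ) ^ 2 * sys.obar * (2 * sys.obar * Fintype.card Λ) ^ (2 * k + 1))
        ≤ ‖(sys.orderPlus ^ (k + 1)) Φ‖ :=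
    Real.sqrt_le_iff.mpr ⟨norm_nonneg _, ha2⟩
  have hsq' : Real.sqrt ((2 * (μ * sys.obar * Fintype.card Λ) ^ 2) ^ (k + 1)
      - ((k + 1 : ℕ) : ℝ) ^ 2 * sys.obar * (2 * sys.obar * Fintype.card Λ) ^ (2 * k + 1))
        ≤ ‖(sys.orderMinus ^ (k + 1)) Φ‖ :=
    Real.sqrt_le_iff.mpr ⟨norm_nonneg _, hb2⟩
  have hprod : (2 * (μ * sys.obar * Fintype.card Λ) ^ 2) ^ (k + 1)
      - ((k + 1 : ℕ) : ℝ) ^ 2 * sys.obar * (2 * sys.obar * Fintype.card Λ) ^ (2 * k + 1)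
        ≤ ‖(sys.orderPlus ^ (k + 1)) Φ‖ * ‖(sys.orderMinus ^ (k + 1)) Φ‖ := by
    rw [← Real.mul_self_sqrt hL.le]
    exact mul_le_mul hsq hsq' (Real.sqrt_nonneg _) (norm_nonneg _)
  beta_reduce at hamgm
  exact hprod.trans hamgm

end U1System

/-! ### KT94 Theorem 2.5 (2.30): the double limit -/

/-- **KT94 Theorem 2.5, (2.30) (`U(1)` case)**:
`lim_{k→∞} lim_{Λ} N⁻¹ (Ξ^{(k)}, O^{(1)} Ξ^{(k)}) ≥ √2 μ o`, in `ε`–`k₀`–`N₀` form,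
UNIFORMLY over all `U(1)` systems (any lattice, any finite-dimensional Hilbert space) with
order-operator bound `o = ob` and obscured-symmetry-breaking states with LRO parameter `μ`:
for every `ε > 0` there is `k₀` such that for every `k ≥ k₀` there is `N₀` such that
`N⁻¹ Re (Ξ^{(k)}, O^{(1)} Ξ^{(k)}) ≥ √2 μ o - ε` whenever `N ≥ N₀`.  Together with (2.29)
(`theorem_2_5_orderTwo`) and Thm 2.3 (`theorem_2_3`: `Ξ^{(k)}` is low-lying), this is the statement
that the low-lying states `Ξ^{(k)}` "exhibit explicit symmetry breaking" with order parameter at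
least `√2 μ o` along the first axis (KT94, after Thm 2.5).  The `SU(2)` constant `√3` is not
asserted here.
[cite: KomaTasaki1994, Theorem 2.5 (2.30)] -/
def theorem_2_5_orderOne : Prop :=
  ∀ μ ob ε : ℝ, 0 < ε → ∃ k₀ : ℕ, ∀ k : ℕ, k₀ ≤ k → ∃ N₀ : ℕ,
    ∀ {Λ : Type u} [Fintype Λ] {E : Type v} [NormedAddCommGroup E] [InnerProductSpace ℂ E]
      [FiniteDimensional ℂ E] (sys : U1System Λ E) (Φ : E) (EΛ : ℝ),
      IsLROEigenstate sys Φ EΛ μ → sys.obar = ob → N₀ ≤ Fintype.card Λ →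
      Real.sqrt 2 * μ * ob - ε ≤
        (⟪sys.xiState k Φ, sys.order 0 (sys.xiState k Φ)⟫_ℂ).re / Fintype.card Λ

/-- **KT94 Theorem 2.5 (2.30), `U(1)` case — PROVED** (from `U1System.theorem_2_5_orderOne_fin`:
choose `k₀ > √2μo/ε`, then `N₀ > k² 2^{2k-1} o^{2k} / ((√2μo)^{2k} - (√2μo - ε/2)^{2k})`).
[cite: KomaTasaki1994, Theorem 2.5 (2.30)] [cite: KomaTasaki1993, Theorem 7.3 (7.26)] -/
theorem theorem_2_5_orderOne_holds : theorem_2_5_orderOne.{u, v} := by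
  intro μ ob ε hε
  set s : ℝ := Real.sqrt 2 * μ * ob with hs_def
  have hs2 : s ^ 2 = 2 * μ ^ 2 * ob ^ 2 := by
    rw [hs_def, mul_pow, mul_pow, Real.sq_sqrt (by norm_num : (0 : ℝ) ≤ 2)]
  by_cases hεs : s ≤ ε / 2
  · -- trivial case: the target `s - ε` is negative
    refine ⟨1, fun k hk => ⟨0, ?_⟩⟩
    intro Λ _ E _ _ _ sys Φ EΛ hΦ _hob _hN
    have hx := (sys.theorem_2_5_orderOne_fin hΦ k hk).1
    have : 0 ≤ (⟪sys.xiState k Φ, sys.order 0 (sys.xiState k Φ)⟫_ℂ).re / Fintype.card Λ :=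
      div_nonneg hx (Nat.cast_nonneg _)
    linarith
  push Not at hεs
  have hs : 0 < s := by linarith
  -- `k₀ > s / ε`
  refine ⟨⌈s / ε⌉₊ + 1, fun k hk => ?_⟩
  have hk1 : 1 ≤ k := by omega
  have hkε : s ≤ k * ε := by
    have h1 : s / ε ≤ ⌈s / ε⌉₊ := Nat.le_ceil _
    have h2 : ((⌈s / ε⌉₊ + 1 : ℕ) : ℝ) ≤ k := by exact_mod_cast hk
    push_cast at h2
    have h3 : s / ε ≤ k := by linarith
    rwa [div_le_iff₀ hε] at h3
  obtain ⟨k, rfl⟩ : ∃ k', k = k' + 1 := ⟨k - 1, by omega⟩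
  -- the gap `G = s^{2k} - (s - ε/2)^{2k} > 0` and the constant `c = k² 2^{2k-1} ob^{2k}`
  set G : ℝ := (2 * μ ^ 2 * ob ^ 2) ^ (k + 1) - (s - ε / 2) ^ (2 * k + 2) with hG_def
  have hG : 0 < G := by
    have h1 : (s - ε / 2) ^ (2 * k + 2) < s ^ (2 * k + 2) :=
      pow_lt_pow_left₀ (by linarith) (by linarith) (by omega)
    have h2 : s ^ (2 * k + 2) = (2 * μ ^ 2 * ob ^ 2) ^ (k + 1) := by
      rw [← hs2, ← pow_mul]; ring_nf
    rw [hG_def]; linarith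
  set cst : ℝ := ((k : ℝ) + 1) ^ 2 * 2 ^ (2 * k + 1) * ob ^ (2 * k + 2) with hcst_def
  refine ⟨⌈cst / G⌉₊ + 1, ?_⟩
  intro Λ _ E _ _ _ sys Φ EΛ hΦ hob hN
  have hNpos : (0 : ℝ) < Fintype.card Λ := by
    have : 1 ≤ Fintype.card Λ := le_trans (by omega) hN
    exact_mod_cast Nat.lt_of_lt_of_le Nat.zero_lt_one this
  have hNG : cst ≤ Fintype.card Λ * G := by
    have h1 : cst / G ≤ ⌈cst / G⌉₊ := Nat.le_ceil _
    have h2 : ((⌈cst / G⌉₊ + 1 : ℕ) : ℝ) ≤ Fintype.card Λ := by exact_mod_cast hN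
    push_cast at h2
    have h3 : cst / G ≤ Fintype.card Λ := by linarith
    rwa [div_le_iff₀ hG] at h3
  obtain ⟨hx0, hfin⟩ := sys.theorem_2_5_orderOne_fin hΦ (k + 1) hk1
  rw [hob] at hfin
  -- abbreviations
  set N : ℝ := (Fintype.card Λ : ℝ) with hN_def
  set x : ℝ := (⟪sys.xiState (k + 1) Φ, sys.order 0 (sys.xiState (k + 1) Φ)⟫_ℂ).re with hx_def
  by_contra hcon
  push Not at hcon
  -- `x < (s - ε) N`, hence `r x < (s - ε/2) N` with `r = (2k+3)/(2k+2)`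
  have hxlt : x < (s - ε) * N := by rwa [div_lt_iff₀ hNpos] at hcon
  have hsε : 0 < s - ε := by
    by_contra h
    push Not at h
    have : x < 0 := lt_of_lt_of_le hxlt (mul_nonpos_of_nonpos_of_nonneg h hNpos.le)
    linarith
  have hr0 : (0 : ℝ) < (2 * ((k + 1 : ℕ) : ℝ) + 1) / (2 * ((k + 1 : ℕ) : ℝ)) := by positivity
  have hr : (2 * ((k + 1 : ℕ) : ℝ) + 1) / (2 * ((k + 1 : ℕ) : ℝ)) * ((s - ε) * N)
      ≤ (s - ε / 2) * N := by
    rw [div_mul_eq_mul_div, div_le_iff₀ (by positivity)]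
    push_cast
    have hkε' : s ≤ ((k : ℝ) + 1) * ε := by push_cast at hkε; exact hkε
    nlinarith
  have hrx : (2 * ((k + 1 : ℕ) : ℝ) + 1) / (2 * ((k + 1 : ℕ) : ℝ)) * x < (s - ε / 2) * N :=
    lt_of_lt_of_le (mul_lt_mul_of_pos_left hxlt hr0) hr
  have hpow : ((2 * ((k + 1 : ℕ) : ℝ) + 1) / (2 * ((k + 1 : ℕ) : ℝ)) * x) ^ (2 * (k + 1))
      < ((s - ε / 2) * N) ^ (2 * (k + 1)) :=
    pow_lt_pow_left₀ hrx (mul_nonneg hr0.le hx0) (by omega)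
  -- `L ≥ ((s - ε/2) N)^{2k+2}`
  have e1 : 2 * (k + 1) - 1 = 2 * k + 1 := by omega
  rw [e1] at hfin
  have hkey : (2 * (μ * ob * N) ^ 2) ^ (k + 1)
      - ((k + 1 : ℕ) : ℝ) ^ 2 * ob * (2 * ob * N) ^ (2 * k + 1)
      - ((s - ε / 2) * N) ^ (2 * (k + 1)) = N ^ (2 * k + 1) * (N * G - cst) := by
    rw [hG_def, hcst_def, mul_pow (s - ε / 2) N]
    push_cast
    ring
  have hLge : ((s - ε / 2) * N) ^ (2 * (k + 1)) ≤ (2 * (μ * ob * N) ^ 2) ^ (k + 1)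
      - ((k + 1 : ℕ) : ℝ) ^ 2 * ob * (2 * ob * N) ^ (2 * k + 1) := by
    have : 0 ≤ N ^ (2 * k + 1) * (N * G - cst) :=
      mul_nonneg (pow_nonneg hNpos.le _) (by linarith)
    linarith
  -- contradiction
  have := lt_of_le_of_lt (hLge.trans hfin) hpow
  exact lt_irrefl _ this

/-- **KT94 Theorem 2.5 (2.30) along a sequence of lattices** (`U(1)` case): for `U(1)` systems on
lattices `Λ_j` with `N_j → ∞`, common order-operator bound `o` and LRO parameter `μ`,
`∀ ε > 0, ∃ k₀, ∀ k ≥ k₀, ∀ᶠ j, N_j⁻¹ Re (Ξ^{(k)}_j, O^{(1)}_j Ξ^{(k)}_j) ≥ √2 μ o - ε`, i.e.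
`liminf_k liminf_j N_j⁻¹ (Ξ^{(k)}_j, O^{(1)}_j Ξ^{(k)}_j) ≥ √2 μ o`.
[cite: KomaTasaki1994, Theorem 2.5 (2.30)] -/
theorem theorem_2_5_orderOne_seq (Λ : ℕ → Type u) [∀ j, Fintype (Λ j)] (E : ℕ → Type v)
    [∀ j, NormedAddCommGroup (E j)] [∀ j, InnerProductSpace ℂ (E j)]
    [∀ j, FiniteDimensional ℂ (E j)] (sys : ∀ j, U1System (Λ j) (E j)) (Φ : ∀ j, E j)
    (EΛ : ℕ → ℝ) (μ ob : ℝ) (hΦ : ∀ j, IsLROEigenstate (sys j) (Φ j) (EΛ j) μ)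
    (hob : ∀ j, (sys j).obar = ob) (hN : Tendsto (fun j => Fintype.card (Λ j)) atTop atTop) :
    ∀ ε : ℝ, 0 < ε → ∃ k₀ : ℕ, ∀ k : ℕ, k₀ ≤ k → ∀ᶠ j in atTop,
      Real.sqrt 2 * μ * ob - ε ≤
        (⟪(sys j).xiState k (Φ j), (sys j).order 0 ((sys j).xiState k (Φ j))⟫_ℂ).re
          / Fintype.card (Λ j) := by
  intro ε hε
  obtain ⟨k₀, hk₀⟩ := theorem_2_5_orderOne_holds.{u, v} μ ob ε hε
  refine ⟨k₀, fun k hk => ?_⟩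
  obtain ⟨N₀, hN₀⟩ := hk₀ k hk
  filter_upwards [Filter.tendsto_atTop.mp hN N₀] with j hj
  exact hN₀ (sys j) (Φ j) (EΛ j) (hΦ j) (hob j) hj

/-! ## The `SU(2)` case: constant `√3` (KT93 Theorem 6.1, Corollary 7.2; KT94 remark after
Theorem 2.5; Tasaki 2019 Theorem 3.4) -/

section GenericSU2

variable {E : Type v} [NormedAddCommGroup E] [InnerProductSpace ℂ E]

/-- `[G, A^n] = Σ_{p<n} A^p [G, A] A^{n-1-p}`. [folklore] -/
private theorem comm_pow_eq_sum {R : Type*} [Ring R] (G A : R) (n : ℕ) :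
    G * A ^ n - A ^ n * G = ∑ p ∈ range n, A ^ p * (G * A - A * G) * A ^ (n - 1 - p) := by
  induction n with
  | zero => simp
  | succ n ih =>
    have hsplit : G * A ^ (n + 1) - A ^ (n + 1) * G =
        (G * A ^ n - A ^ n * G) * A + A ^ n * (G * A - A * G) := by
      rw [pow_succ]; noncomm_ring
    rw [hsplit, ih, sum_range_succ, Finset.sum_mul]
    congr 1
    · refine Finset.sum_congr rfl fun p hp => ?_
      rw [mem_range] at hp
      rw [mul_assoc, ← pow_succ, show n - 1 - p + 1 = n + 1 - 1 - p by omega]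
    · rw [show n + 1 - 1 - n = 0 by omega, pow_zero, mul_one]

/-- Commutator of a generator `G` with the word `B A^n` when `[G, B] = ε A`, `[G, A] = -ε B`:
`[G, B A^n] = ε (A^{n+1} - Σ_{p<n} B A^p B A^{n-1-p})`. [folklore] -/
private theorem comm_mul_pow_eq {R : Type*} [Ring R] [Algebra ℂ R] (G A B : R) (ε : ℂ)
    (hB : G * B - B * G = ε • A) (hA : G * A - A * G = -(ε • B)) (n : ℕ) :
    G * (B * A ^ n) - B * A ^ n * G =
      ε • (A ^ (n + 1) - ∑ p ∈ range n, B * A ^ p * B * A ^ (n - 1 - p)) := by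
  have h1 : G * (B * A ^ n) - B * A ^ n * G =
      (G * B - B * G) * A ^ n + B * (G * A ^ n - A ^ n * G) := by noncomm_ring
  rw [h1, hB, comm_pow_eq_sum, hA, smul_sub, pow_succ', smul_mul_assoc, Finset.mul_sum,
    Finset.smul_sum, sub_eq_add_neg, ← Finset.sum_neg_distrib]
  congr 1
  refine Finset.sum_congr rfl fun p _ => ?_
  simp only [mul_neg, neg_mul, mul_smul_comm, smul_mul_assoc, mul_assoc]

/-- If `G` is symmetric, `G Φ = c Φ` with `c` real, and `G` commutes with `W`, then
`⟪Φ, W [G, S] Φ⟫ = 0`. [folklore] -/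
private theorem inner_mul_comm_eq_zero (G W S : E →L[ℂ] E) {Φ : E} {c : ℂ}
    (hG : ∀ x y : E, ⟪G x, y⟫_ℂ = ⟪x, G y⟫_ℂ) (hΦ : G Φ = c • Φ) (hc : conj c = c)
    (hW : Commute G W) :
    ⟪Φ, (W * (G * S - S * G)) Φ⟫_ℂ = 0 := by
  have h1 : W * (G * S - S * G) = G * (W * S) - (W * S) * G := by
    rw [mul_sub, ← mul_assoc, ← hW.eq]; noncomm_ring
  rw [h1, sub_apply, inner_sub_right]
  simp only [mul_apply_eq_comp]
  rw [← hG, hΦ, inner_smul_left, map_smul, map_smul, inner_smul_right, hc, sub_self]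

/-- The rotation identity behind KT93 (6.12)–(6.13) in infinitesimal form: with `G`, `W`, `Φ`
as above and `[G, B] = ε A`, `[G, A] = -ε B`, `ε ≠ 0`,
`⟪Φ, W A^{n+1} Φ⟫ = Σ_{p<n} ⟪Φ, W B A^p B A^{n-1-p} Φ⟫`. [folklore] -/
private theorem inner_mul_pow_eq_sum (G W A B : E →L[ℂ] E) {Φ : E} {c ε : ℂ}
    (hG : ∀ x y : E, ⟪G x, y⟫_ℂ = ⟪x, G y⟫_ℂ) (hΦ : G Φ = c • Φ) (hc : conj c = c)
    (hW : Commute G W) (hB : G * B - B * G = ε • A) (hA : G * A - A * G = -(ε • B))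
    (hε : ε ≠ 0) (n : ℕ) :
    ⟪Φ, (W * A ^ (n + 1)) Φ⟫_ℂ =
      ∑ p ∈ range n, ⟪Φ, (W * (B * A ^ p * B * A ^ (n - 1 - p))) Φ⟫_ℂ := by
  have h0 := inner_mul_comm_eq_zero G W (B * A ^ n) hG hΦ hc hW
  rw [comm_mul_pow_eq G A B ε hB hA n, mul_smul_comm, smul_apply,
    inner_smul_right, mul_eq_zero] at h0
  have h1 := h0.resolve_left hε
  rw [mul_sub, sub_apply, inner_sub_right, sub_eq_zero, Finset.mul_sum,
    _root_.sum_apply, inner_sum] at h1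
  exact h1

/-- `|Re ⟪Φ, X Φ⟫ - Re ⟪Φ, Y Φ⟫| ≤ ‖X - Y‖` for a unit vector `Φ`. [folklore] -/
private theorem abs_re_inner_sub_le (X Y : E →L[ℂ] E) {Φ : E} (hΦ : ‖Φ‖ = 1) :
    |(⟪Φ, X Φ⟫_ℂ).re - (⟪Φ, Y Φ⟫_ℂ).re| ≤ ‖X - Y‖ := by
  have h : (⟪Φ, X Φ⟫_ℂ).re - (⟪Φ, Y Φ⟫_ℂ).re = (⟪Φ, (X - Y) Φ⟫_ℂ).re := by
    rw [sub_apply, inner_sub_right, Complex.sub_re]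
  rw [h]
  calc |(⟪Φ, (X - Y) Φ⟫_ℂ).re| ≤ ‖⟪Φ, (X - Y) Φ⟫_ℂ‖ := Complex.abs_re_le_norm _
    _ ≤ ‖Φ‖ * ‖(X - Y) Φ‖ := norm_inner_le_norm _ _
    _ ≤ ‖Φ‖ * (‖X - Y‖ * ‖Φ‖) := by gcongr; exact (X - Y).le_opNorm Φ
    _ = ‖X - Y‖ := by rw [hΦ]; ring

/-- Reordering one letter: `‖W B A^p B A^m - W B² A^{p+m}‖ ≤ ‖W‖ p c β^{p+m+1}` when
`‖A‖, ‖B‖ ≤ β` and `‖B A - A B‖ ≤ c β`. [folklore] -/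
private theorem norm_word_sub_le (W A B : E →L[ℂ] E) {β c : ℝ} (hβ : 0 ≤ β) (hc : 0 ≤ c)
    (hA : ‖A‖ ≤ β) (hB : ‖B‖ ≤ β) (hBA : ‖B * A - A * B‖ ≤ c * β) (p m : ℕ) :
    ‖W * (B * A ^ p * B * A ^ m) - W * (B * B * A ^ (p + m))‖ ≤ ‖W‖ * (p * c * β ^ (p + m + 1)) := by
  have h1 : W * (B * A ^ p * B * A ^ m) - W * (B * B * A ^ (p + m)) =
      W * (B * (A ^ p * B - B * A ^ p) * A ^ m) := by
    rw [pow_add]; noncomm_ring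
  have h2 : ‖A ^ p * B - B * A ^ p‖ ≤ p * c * β ^ p := by
    rw [← norm_neg, neg_sub]
    exact norm_comm_pow_le B A hβ hc hA hBA p
  have h3 : ‖A ^ m‖ ≤ β ^ m := norm_pow_le_of_le hA m
  have h4 : (0 : ℝ) ≤ p * c * β ^ p := mul_nonneg (mul_nonneg (Nat.cast_nonneg _) hc) (pow_nonneg hβ _)
  rw [h1]
  calc ‖W * (B * (A ^ p * B - B * A ^ p) * A ^ m)‖
      ≤ ‖W‖ * (‖B‖ * ‖A ^ p * B - B * A ^ p‖ * ‖A ^ m‖) := by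
        refine (norm_mul_le _ _).trans ?_
        gcongr
        exact (norm_mul_le _ _).trans (mul_le_mul_of_nonneg_right (norm_mul_le _ _) (norm_nonneg _))
    _ ≤ ‖W‖ * (β * (p * c * β ^ p) * β ^ m) :=
        mul_le_mul_of_nonneg_left
          (mul_le_mul (mul_le_mul hB h2 (norm_nonneg _) hβ) h3 (norm_nonneg _)
            (mul_nonneg hβ h4)) (norm_nonneg W)
    _ = ‖W‖ * (p * c * β ^ (p + m + 1)) := by ring

end GenericSU2

section GenericSU2b

variable {E : Type v} [NormedAddCommGroup E] [InnerProductSpace ℂ E]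

/-- The averaged reordering estimate behind KT93 (6.13) / Tasaki 2019 (4.48)–(4.49), in
infinitesimal form: with `G`, `W`, `A`, `B`, `Φ` as in `inner_mul_pow_eq_sum` and
`‖A‖, ‖B‖ ≤ β`, `‖[B, A]‖ ≤ c β`, `‖W‖ ≤ w`,
`|Re ⟪Φ, W A^{n+1} Φ⟫ - n Re ⟪Φ, W B² A^{n-1} Φ⟫| ≤ w n² c β^n`. [folklore] -/
private theorem rot_estimate (G W A B : E →L[ℂ] E) {Φ : E} {c ε : ℂ} {β cc w : ℝ}
    (hG : ∀ x y : E, ⟪G x, y⟫_ℂ = ⟪x, G y⟫_ℂ) (hΦ : G Φ = c • Φ) (hc : conj c = c)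
    (hW : Commute G W) (hB : G * B - B * G = ε • A) (hA : G * A - A * G = -(ε • B))
    (hε : ε ≠ 0) (hβ : 0 ≤ β) (hcc : 0 ≤ cc) (hA' : ‖A‖ ≤ β) (hB' : ‖B‖ ≤ β)
    (hBA : ‖B * A - A * B‖ ≤ cc * β) (hWn : ‖W‖ ≤ w) (hΦ1 : ‖Φ‖ = 1) (n : ℕ) :
    |(⟪Φ, (W * A ^ (n + 1)) Φ⟫_ℂ).re - n * (⟪Φ, (W * (B * B * A ^ (n - 1))) Φ⟫_ℂ).re|
      ≤ w * (n ^ 2 * cc * β ^ n) := by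
  rw [inner_mul_pow_eq_sum G W A B hG hΦ hc hW hB hA hε n, Complex.re_sum]
  have hn : (n : ℝ) * (⟪Φ, (W * (B * B * A ^ (n - 1))) Φ⟫_ℂ).re
      = ∑ _p ∈ range n, (⟪Φ, (W * (B * B * A ^ (n - 1))) Φ⟫_ℂ).re := by
    rw [Finset.sum_const, card_range, nsmul_eq_mul]
  rw [hn, ← Finset.sum_sub_distrib]
  refine (Finset.abs_sum_le_sum_abs _ _).trans ?_
  have hw : 0 ≤ w := (norm_nonneg _).trans hWn
  calc ∑ p ∈ range n, |(⟪Φ, (W * (B * A ^ p * B * A ^ (n - 1 - p))) Φ⟫_ℂ).re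
          - (⟪Φ, (W * (B * B * A ^ (n - 1))) Φ⟫_ℂ).re|
      ≤ ∑ p ∈ range n, ‖W‖ * (p * cc * β ^ n) := by
        refine Finset.sum_le_sum fun p hp => ?_
        rw [mem_range] at hp
        have h := norm_word_sub_le W A B hβ hcc hA' hB' hBA p (n - 1 - p)
        rw [show p + (n - 1 - p) = n - 1 by omega, show n - 1 + 1 = n by omega] at h
        exact (abs_re_inner_sub_le _ _ hΦ1).trans h
    _ ≤ ∑ _p ∈ range n, w * (n * cc * β ^ n) := by
        refine Finset.sum_le_sum fun p hp => ?_
        rw [mem_range] at hp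
        have hp' : (p : ℝ) ≤ n := by exact_mod_cast hp.le
        have h1 : ‖W‖ * (p * cc * β ^ n) ≤ w * (p * cc * β ^ n) :=
          mul_le_mul_of_nonneg_right hWn (by positivity)
        refine h1.trans ?_
        gcongr
    _ = w * (n ^ 2 * cc * β ^ n) := by
        rw [Finset.sum_const, card_range, nsmul_eq_mul]; ring

/-- `[G, A² + B²] = 0` when `G A = A G + ε B` and `G B = B G - ε A`. [folklore] -/
private theorem commute_sq_add_sq {R : Type*} [Ring R] [Algebra ℂ R] (G A B : R) (ε : ℂ)
    (hA : G * A = A * G + ε • B) (hB : G * B = B * G - ε • A) :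
    Commute G (A * A + B * B) := by
  show G * (A * A + B * B) = (A * A + B * B) * G
  calc G * (A * A + B * B) = (G * A) * A + (G * B) * B := by noncomm_ring
    _ = (A * G + ε • B) * A + (B * G - ε • A) * B := by rw [hA, hB]
    _ = A * (G * A) + B * (G * B) + ε • (B * A) - ε • (A * B) := by
        simp only [add_mul, sub_mul, smul_mul_assoc, mul_assoc]; abel
    _ = A * (A * G + ε • B) + B * (B * G - ε • A) + ε • (B * A) - ε • (A * B) := by rw [hA, hB]
    _ = (A * A + B * B) * G := by
        simp only [mul_add, mul_sub, mul_smul_comm, mul_assoc, add_mul]; abel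

end GenericSU2b

/-! ### The `SU(2)` datum (KT93 §2 iv), v); §7 i'')) -/

section SU2

variable {Λ : Type u} [Fintype Λ] {E : Type v} [NormedAddCommGroup E] [InnerProductSpace ℂ E]

/-! ### Rotation averaging in infinitesimal form (KT93 Theorem 6.1, Lemmas 6.2–6.3) -/

namespace U1System

variable (sys : U1System Λ E)

/-- (2.14) as `C O^{(1)} = O^{(1)} C + i O^{(2)}`. [cite: KomaTasaki1994, (2.14)] -/
theorem C_mul_order0 : sys.C * sys.order 0 = sys.order 0 * sys.C + I • sys.order 1 := by
  have h := sys.order_zero_C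
  change sys.order 0 * sys.C - sys.C * sys.order 0 = -(I • sys.order 1) at h
  calc sys.C * sys.order 0
      = sys.order 0 * sys.C - (sys.order 0 * sys.C - sys.C * sys.order 0) := by abel
    _ = sys.order 0 * sys.C + I • sys.order 1 := by rw [h, sub_neg_eq_add]

/-- (2.14) as `C O^{(2)} = O^{(2)} C - i O^{(1)}`. [cite: KomaTasaki1994, (2.14)] -/
theorem C_mul_order1 : sys.C * sys.order 1 = sys.order 1 * sys.C - I • sys.order 0 := by
  have h := sys.order_one_C
  change sys.order 1 * sys.C - sys.C * sys.order 1 = I • sys.order 0 at h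
  calc sys.C * sys.order 1
      = sys.order 1 * sys.C - (sys.order 1 * sys.C - sys.C * sys.order 1) := by abel
    _ = sys.order 1 * sys.C - I • sys.order 0 := by rw [h]

/-- `[C, (O^{(1)})² + (O^{(2)})²] = 0`. [cite: KomaTasaki1993, §6 (rotation invariance of `(O)²`)] -/
theorem commute_C_orderSq : Commute sys.C sys.orderSq :=
  commute_sq_add_sq sys.C (sys.order 0) (sys.order 1) I sys.C_mul_order0 sys.C_mul_order1

/-- `Q (O^{(1)})^{2K} = (O^{(1)})^{2K+2} + (O^{(2)})² (O^{(1)})^{2K}`. [cite: KomaTasaki1993, (6.11)] -/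
theorem orderSq_mul_pow (K : ℕ) : sys.orderSq * sys.order 0 ^ (2 * K) =
    sys.order 0 ^ (2 * K + 2) + sys.order 1 * sys.order 1 * sys.order 0 ^ (2 * K) := by
  rw [orderSq, add_mul, show sys.order 0 * sys.order 0 * sys.order 0 ^ (2 * K)
    = sys.order 0 ^ (2 * K + 2) by rw [pow_succ', pow_succ', mul_assoc]]

/-- KT93 (6.13) with `X^{(3)} = C`: for `W` commuting with `C` and a `C`-eigenvector `Φ`,
`|Re ⟪Φ, W (O^{(1)})^{n+1} Φ⟫ - n Re ⟪Φ, W (O^{(2)})² (O^{(1)})^{n-1} Φ⟫| ≤ ‖W‖ n² 2o (oN)^n`.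
[cite: KomaTasaki1993, Theorem 6.1 (6.13), Lemma 6.3] -/
theorem rotC_estimate {Φ : E} {EΛ μ : ℝ} (hΦ : IsLROEigenstate sys Φ EΛ μ) (W : E →L[ℂ] E)
    {w : ℝ} (hW : Commute sys.C W) (hWn : ‖W‖ ≤ w) (n : ℕ) :
    |(⟪Φ, (W * sys.order 0 ^ (n + 1)) Φ⟫_ℂ).re
        - n * (⟪Φ, (W * (sys.order 1 * sys.order 1 * sys.order 0 ^ (n - 1))) Φ⟫_ℂ).re|
      ≤ w * (n ^ 2 * (2 * sys.obar) * (sys.obar * Fintype.card Λ) ^ n) := by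
  obtain ⟨c, hC⟩ := hΦ.eigen_C
  have hΦne : Φ ≠ 0 := by
    intro h0; have h1 := hΦ.norm_eq_one; rw [h0, norm_zero] at h1; exact zero_ne_one h1
  have hc : conj c = c := sys.conj_eq_of_eigen_C hΦne hC
  have hG : ∀ x y : E, ⟪sys.C x, y⟫_ℂ = ⟪x, sys.C y⟫_ℂ := fun x y => sys.isSymmetric_C x y
  have hB : sys.C * sys.order 1 - sys.order 1 * sys.C = (-I) • sys.order 0 := by
    rw [C_mul_order1, neg_smul]; abel
  have hA : sys.C * sys.order 0 - sys.order 0 * sys.C = -((-I) • sys.order 1) := by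
    rw [C_mul_order0, neg_smul, neg_neg]; abel
  have hε : (-I : ℂ) ≠ 0 := neg_ne_zero.mpr I_ne_zero
  have ho : 0 ≤ sys.obar := sys.obar_pos.le
  have hR : 0 ≤ sys.obar * Fintype.card Λ := by positivity
  have hBA : ‖sys.order 1 * sys.order 0 - sys.order 0 * sys.order 1‖
      ≤ 2 * sys.obar * (sys.obar * Fintype.card Λ) := by
    rw [← norm_neg, neg_sub]
    calc _ ≤ 2 * sys.obar ^ 2 * Fintype.card Λ := sys.norm_comm_order_le
      _ = _ := by ring
  exact rot_estimate sys.C W (sys.order 0) (sys.order 1) hG hC hc hW hB hA hε hR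
    (by positivity) (sys.norm_order_le 0) (sys.norm_order_le 1) hBA hWn hΦ.norm_eq_one n

/-- One peeling step of the `U(1)` average (KT93 Lemma 7.5 / remark after Theorem 6.1, factor
`√2`): with `Q = (O^{(1)})² + (O^{(2)})²`,
`|(2K+1) Re⟪Q^{j+1} (O^{(1)})^{2K}⟫ - (2K+2) Re⟪Q^j (O^{(1)})^{2K+2}⟫| = O(N^{2j+2K+1})`.
[cite: KomaTasaki1993, Lemma 7.5, Theorem 6.1 (remark)] -/
theorem stepQ {Φ : E} {EΛ μ : ℝ} (hΦ : IsLROEigenstate sys Φ EΛ μ) (j K : ℕ) :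
    |(2 * K + 1) * (⟪Φ, (sys.orderSq ^ (j + 1) * sys.order 0 ^ (2 * K)) Φ⟫_ℂ).re
        - (2 * K + 2) * (⟪Φ, (sys.orderSq ^ j * sys.order 0 ^ (2 * K + 2)) Φ⟫_ℂ).re|
      ≤ (4 * (sys.obar * Fintype.card Λ) ^ 2) ^ j
          * ((2 * K + 1) ^ 2 * (2 * sys.obar) * (sys.obar * Fintype.card Λ) ^ (2 * K + 1)) := by
  have hsplit : sys.orderSq ^ (j + 1) * sys.order 0 ^ (2 * K) =
      sys.orderSq ^ j * sys.order 0 ^ (2 * K + 2)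
        + sys.orderSq ^ j * (sys.order 1 * sys.order 1 * sys.order 0 ^ (2 * K)) := by
    rw [pow_succ, mul_assoc, orderSq_mul_pow, mul_add]
  have hW : Commute sys.C (sys.orderSq ^ j) := sys.commute_C_orderSq.pow_right j
  have hQ4 : ‖sys.orderSq‖ ≤ 4 * (sys.obar * Fintype.card Λ) ^ 2 :=
    sys.norm_orderSq_le.trans_eq (by ring)
  have hWn : ‖sys.orderSq ^ j‖ ≤ (4 * (sys.obar * Fintype.card Λ) ^ 2) ^ j :=
    norm_pow_le_of_le hQ4 j
  have h2 := sys.rotC_estimate hΦ (sys.orderSq ^ j) hW hWn (2 * K + 1)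
  rw [show 2 * K + 1 - 1 = 2 * K by omega] at h2
  rw [hsplit, add_apply, inner_add_right, Complex.add_re]
  push_cast at h2 ⊢
  obtain ⟨h2a, h2b⟩ := abs_le.mp h2
  exact abs_le.mpr ⟨by linarith, by linarith⟩

end U1System

/-- **`SU(2)` datum** for a `U(1)` system (KT93 §2, (2.14)–(2.16) and conditions iv), v); KT94
remark after Theorem 2.5 "when the model has an `SU(2)` symmetry"): a third order-operator density
`o^{(3)}_x` (self-adjoint, `‖o^{(3)}_x‖ ≤ o`, commuting with all densities at other sites — iv)),
and generators `X^{(1)} = J 0`, `X^{(2)} = J 1` which together with `X^{(3)} = C_Λ` (KT94 (2.14) is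
v) for `j = 3`) rotate `(O^{(1)}, O^{(2)}, O^{(3)})` as a vector:
`[X^{(j)}, O^{(k)}] = i Σ_l ε_{jkl} O^{(l)}` (v), KT93 (2.16)), plus `[C_Λ, O^{(3)}] = 0` (v) for
`j = k = 3`).  The `su(2)` relations among the `X^{(j)}` (KT93 (2.15)) and vi) `[H_Λ, X^{(j)}] = 0`
are not needed below and not recorded.  For the Heisenberg antiferromagnet / half-filled Hubbard
model: `X = S_tot`, `o^{(α)}_x = ε_x S^{(α)}_x`.
[cite: KomaTasaki1993, §2 (2.14)–(2.16), iv), v)] -/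
structure SU2Datum (sys : U1System Λ E) where
  /-- the third order-operator density `o^{(3)}_x` -/
  o₃ : Λ → E →L[ℂ] E
  /-- the generators `X^{(1)} = J 0`, `X^{(2)} = J 1` (`X^{(3)} = C_Λ`) -/
  J : Fin 2 → E →L[ℂ] E
  isSymmetric_o₃ : ∀ x, (o₃ x : E →ₗ[ℂ] E).IsSymmetric
  isSymmetric_J : ∀ a, (J a : E →ₗ[ℂ] E).IsSymmetric
  /-- ii) for `o^{(3)}` -/
  norm_o₃_le : ∀ x, ‖o₃ x‖ ≤ sys.obar
  /-- iv) -/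
  commute_o_o₃ : ∀ x y, x ≠ y → ∀ α, Commute (sys.o α x) (o₃ y)
  /-- iv) -/
  commute_o₃_o₃ : ∀ x y, x ≠ y → Commute (o₃ x) (o₃ y)
  /-- v), `j = 1`: `[X^{(1)}, O^{(1)}] = 0`, `[X^{(1)}, O^{(2)}] = i O^{(3)}`,
  `[X^{(1)}, O^{(3)}] = -i O^{(2)}` -/
  J0_order0 : Commute (J 0) (sys.order 0)
  J0_order1 : J 0 * sys.order 1 - sys.order 1 * J 0 = I • ∑ x, o₃ x
  J0_order3 : J 0 * (∑ x, o₃ x) - (∑ x, o₃ x) * J 0 = -(I • sys.order 1)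
  /-- v), `j = 2`: `[X^{(2)}, O^{(1)}] = -i O^{(3)}`, `[X^{(2)}, O^{(2)}] = 0`,
  `[X^{(2)}, O^{(3)}] = i O^{(1)}` -/
  J1_order0 : J 1 * sys.order 0 - sys.order 0 * J 1 = -(I • ∑ x, o₃ x)
  J1_order1 : Commute (J 1) (sys.order 1)
  J1_order3 : J 1 * (∑ x, o₃ x) - (∑ x, o₃ x) * J 1 = I • sys.order 0
  /-- v), `j = k = 3`: `[C_Λ, O^{(3)}] = 0` -/
  order3_C : Commute (∑ x, o₃ x) sys.C

namespace SU2Datum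

variable {sys : U1System Λ E} (d : SU2Datum sys)

/-- `O^{(3)} = Σ_x o^{(3)}_x`. [cite: KomaTasaki1993, (2.14)] -/
def order3 : E →L[ℂ] E := ∑ x, d.o₃ x

/-- `(O_Λ)² = (O^{(1)})² + (O^{(2)})² + (O^{(3)})²` (KT93 (6.11)). [cite: KomaTasaki1993, (6.11)] -/
def totSq : E →L[ℂ] E := sys.orderSq + d.order3 * d.order3

/-- `O^{(3)}` is symmetric. [cite: KomaTasaki1993, (2.14)] -/
theorem isSymmetric_order3 : (d.order3 : E →ₗ[ℂ] E).IsSymmetric := by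
  intro φ ψ
  simp only [order3, ContinuousLinearMap.toLinearMap_sum, LinearMap.coe_sum,
    ContinuousLinearMap.coe_coe, Finset.sum_apply, sum_inner, inner_sum]
  exact Finset.sum_congr rfl fun x _ => d.isSymmetric_o₃ x φ ψ

/-- `‖O^{(3)}‖ ≤ o N`. [cite: KomaTasaki1993, §2 ii)] -/
theorem norm_order3_le : ‖d.order3‖ ≤ sys.obar * Fintype.card Λ := by
  calc ‖d.order3‖ = ‖∑ y, d.o₃ y‖ := rfl
    _ ≤ ∑ y, ‖d.o₃ y‖ := norm_sum_le _ _
    _ ≤ ∑ _y : Λ, sys.obar := Finset.sum_le_sum fun y _ => d.norm_o₃_le y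
    _ = sys.obar * Fintype.card Λ := by
        rw [Finset.sum_const, Finset.card_univ, nsmul_eq_mul]; ring

/-- `‖[O^{(α)}, O^{(3)}]‖ ≤ 2 o² N` (by iv) the commutator is `Σ_y [o^{(α)}_y, o^{(3)}_y]`).
[cite: KomaTasaki1993, §2 iv), Lemma 6.3] -/
theorem norm_comm_order_order3_le (α : Fin 2) :
    ‖sys.order α * d.order3 - d.order3 * sys.order α‖ ≤ 2 * sys.obar ^ 2 * Fintype.card Λ := by
  rw [U1System.order, order3, sum_mul_sum_sub_sum_mul_sum _ _ _
    (fun y _ z _ hyz => (d.commute_o_o₃ y z hyz α).eq)]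
  calc ‖∑ y, (sys.o α y * d.o₃ y - d.o₃ y * sys.o α y)‖
      ≤ ∑ y, ‖sys.o α y * d.o₃ y - d.o₃ y * sys.o α y‖ := norm_sum_le _ _
    _ ≤ ∑ _y : Λ, 2 * sys.obar ^ 2 := by
        refine Finset.sum_le_sum fun y _ => ?_
        calc ‖sys.o α y * d.o₃ y - d.o₃ y * sys.o α y‖
            ≤ 2 * ‖sys.o α y‖ * ‖d.o₃ y‖ := norm_comm_le _ _
          _ ≤ 2 * sys.obar * sys.obar := by
              have := sys.norm_o_le α y; have := d.norm_o₃_le y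
              have : 0 ≤ sys.obar := sys.obar_pos.le
              gcongr
          _ = 2 * sys.obar ^ 2 := by ring
    _ = 2 * sys.obar ^ 2 * Fintype.card Λ := by
        rw [Finset.sum_const, nsmul_eq_mul, Finset.card_univ]; ring

/-- v) for `X^{(2)}`: `X^{(2)} O^{(3)} = O^{(3)} X^{(2)} + i O^{(1)}`. [cite: KomaTasaki1993, (2.16)] -/
theorem J1_mul_order3 : d.J 1 * d.order3 = d.order3 * d.J 1 + I • sys.order 0 := by
  have h := d.J1_order3
  change d.J 1 * d.order3 - d.order3 * d.J 1 = I • sys.order 0 at h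
  rw [sub_eq_iff_eq_add'] at h
  rw [h]

/-- v) for `X^{(2)}`: `X^{(2)} O^{(1)} = O^{(1)} X^{(2)} - i O^{(3)}`. [cite: KomaTasaki1993, (2.16)] -/
theorem J1_mul_order0 : d.J 1 * sys.order 0 = sys.order 0 * d.J 1 - I • d.order3 := by
  have h := d.J1_order0
  change d.J 1 * sys.order 0 - sys.order 0 * d.J 1 = -(I • d.order3) at h
  rw [sub_eq_iff_eq_add'] at h
  rw [h, ← sub_eq_add_neg]

/-- `[C, (O)²] = 0`. [cite: KomaTasaki1993, §6] -/
theorem commute_C_totSq : Commute sys.C d.totSq := by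
  have h3 : Commute sys.C d.order3 := by
    have := d.order3_C; exact (this.symm : Commute sys.C (∑ x, d.o₃ x))
  exact sys.commute_C_orderSq.add_right (h3.mul_right h3)

/-- `[X^{(2)}, (O)²] = 0`. [cite: KomaTasaki1993, §6] -/
theorem commute_J1_totSq : Commute (d.J 1) d.totSq := by
  have h13 : Commute (d.J 1) (d.order3 * d.order3 + sys.order 0 * sys.order 0) :=
    commute_sq_add_sq (d.J 1) d.order3 (sys.order 0) I d.J1_mul_order3 d.J1_mul_order0
  have h2 : Commute (d.J 1) (sys.order 1 * sys.order 1) :=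
    d.J1_order1.mul_right d.J1_order1
  have e : d.totSq = (d.order3 * d.order3 + sys.order 0 * sys.order 0) + sys.order 1 * sys.order 1 := by
    rw [totSq, U1System.orderSq]; abel
  rw [e]
  exact h13.add_right h2

/-- `‖(O)²‖ ≤ 3 (o N)²`. [cite: KomaTasaki1993, §2 ii)] -/
theorem norm_totSq_le : ‖d.totSq‖ ≤ 3 * (sys.obar * Fintype.card Λ) ^ 2 := by
  have h0 := sys.norm_order_le 0
  have h1 := sys.norm_order_le 1
  have h3 := d.norm_order3_le
  have hR : 0 ≤ sys.obar * Fintype.card Λ := by have := sys.obar_pos.le; positivity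
  rw [totSq, U1System.orderSq]
  calc ‖sys.order 0 * sys.order 0 + sys.order 1 * sys.order 1 + d.order3 * d.order3‖
      ≤ ‖sys.order 0 * sys.order 0‖ + ‖sys.order 1 * sys.order 1‖ + ‖d.order3 * d.order3‖ :=
        norm_add₃_le
    _ ≤ ‖sys.order 0‖ * ‖sys.order 0‖ + ‖sys.order 1‖ * ‖sys.order 1‖
          + ‖d.order3‖ * ‖d.order3‖ :=
        add_le_add (add_le_add (norm_mul_le _ _) (norm_mul_le _ _)) (norm_mul_le _ _)
    _ ≤ (sys.obar * Fintype.card Λ) * (sys.obar * Fintype.card Λ)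
          + (sys.obar * Fintype.card Λ) * (sys.obar * Fintype.card Λ)
          + (sys.obar * Fintype.card Λ) * (sys.obar * Fintype.card Λ) := by
        gcongr
    _ = 3 * (sys.obar * Fintype.card Λ) ^ 2 := by ring

/-- `Re ⟪x, (O)² x⟫ = ‖O^{(1)} x‖² + ‖O^{(2)} x‖² + ‖O^{(3)} x‖²`. [cite: KomaTasaki1993, (6.11)] -/
theorem re_inner_totSq (x : E) :
    (⟪x, d.totSq x⟫_ℂ).re = ‖sys.order 0 x‖ ^ 2 + ‖sys.order 1 x‖ ^ 2 + ‖d.order3 x‖ ^ 2 := by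
  have e3 : ⟪x, d.order3 (d.order3 x)⟫_ℂ = ⟪d.order3 x, d.order3 x⟫_ℂ :=
    (d.isSymmetric_order3 x (d.order3 x)).symm
  rw [totSq, add_apply, inner_add_right, Complex.add_re, sys.re_inner_orderSq, mul_apply_eq_comp,
    e3, inner_self_eq_norm_sq_to_K]
  norm_cast

/-- `(O)²` is symmetric. [cite: KomaTasaki1993, (6.11)] -/
theorem isSymmetric_totSq : (d.totSq : E →ₗ[ℂ] E).IsSymmetric := by
  have h3 : ((d.order3 * d.order3 : E →L[ℂ] E) : E →ₗ[ℂ] E).IsSymmetric := by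
    intro x y
    have h := fun a b => d.isSymmetric_order3 a b
    simp only [ContinuousLinearMap.coe_coe] at h
    simp only [ContinuousLinearMap.coe_coe, mul_apply_eq_comp]
    rw [h, h]
  have := sys.isSymmetric_orderSq.add h3
  simpa [totSq] using this

end SU2Datum


namespace SU2Datum

variable {sys : U1System Λ E} (d : SU2Datum sys)

/-- `⟪Φ, (O^{(3)})² Φ⟫ = ⟪Φ, (O^{(1)})² Φ⟫` when `X^{(2)} Φ = 0` (the `k = 1` case of the rotation
average KT93 (6.13)). [cite: KomaTasaki1993, Theorem 6.1 (6.13)] -/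
theorem inner_order3_sq_eq {Φ : E} (hJ : d.J 1 Φ = 0) :
    ⟪Φ, d.order3 (d.order3 Φ)⟫_ℂ = ⟪Φ, sys.order 0 (sys.order 0 Φ)⟫_ℂ := by
  have hG : ∀ x y : E, ⟪d.J 1 x, y⟫_ℂ = ⟪x, d.J 1 y⟫_ℂ := fun x y => d.isSymmetric_J 1 x y
  have hΦ' : d.J 1 Φ = (0 : ℂ) • Φ := by rw [hJ, zero_smul]
  have hB : d.J 1 * d.order3 - d.order3 * d.J 1 = I • sys.order 0 := d.J1_order3
  have hA : d.J 1 * sys.order 0 - sys.order 0 * d.J 1 = -(I • d.order3) := d.J1_order0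
  have h := inner_mul_pow_eq_sum (d.J 1) 1 (sys.order 0) d.order3 hG hΦ' (map_zero _)
    (Commute.one_right _) hB hA I_ne_zero 1
  simp only [sum_range_one, pow_zero, mul_one, one_mul, Nat.sub_self] at h
  rw [show sys.order 0 ^ (1 + 1) = sys.order 0 * sys.order 0 by rw [pow_succ, pow_one],
    mul_apply_eq_comp, mul_apply_eq_comp] at h
  exact h.symm

/-- KT93 (6.13) with `X^{(2)}`: for `W` commuting with `X^{(2)}` and `X^{(2)} Φ = 0`,
`|Re ⟪Φ, W (O^{(1)})^{n+1} Φ⟫ - n Re ⟪Φ, W (O^{(3)})² (O^{(1)})^{n-1} Φ⟫| ≤ ‖W‖ n² 2o (oN)^n`.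
[cite: KomaTasaki1993, Theorem 6.1 (6.13), Lemma 6.3] -/
theorem rotJ_estimate {Φ : E} (hΦ1 : ‖Φ‖ = 1) (hJ : d.J 1 Φ = 0) (W : E →L[ℂ] E)
    {w : ℝ} (hW : Commute (d.J 1) W) (hWn : ‖W‖ ≤ w) (n : ℕ) :
    |(⟪Φ, (W * sys.order 0 ^ (n + 1)) Φ⟫_ℂ).re
        - n * (⟪Φ, (W * (d.order3 * d.order3 * sys.order 0 ^ (n - 1))) Φ⟫_ℂ).re|
      ≤ w * (n ^ 2 * (2 * sys.obar) * (sys.obar * Fintype.card Λ) ^ n) := by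
  have hG : ∀ x y : E, ⟪d.J 1 x, y⟫_ℂ = ⟪x, d.J 1 y⟫_ℂ := fun x y => d.isSymmetric_J 1 x y
  have hΦ' : d.J 1 Φ = (0 : ℂ) • Φ := by rw [hJ, zero_smul]
  have hB : d.J 1 * d.order3 - d.order3 * d.J 1 = I • sys.order 0 := d.J1_order3
  have hA : d.J 1 * sys.order 0 - sys.order 0 * d.J 1 = -(I • d.order3) := d.J1_order0
  have ho : 0 ≤ sys.obar := sys.obar_pos.le
  have hR : 0 ≤ sys.obar * Fintype.card Λ := by positivity
  have hBA : ‖d.order3 * sys.order 0 - sys.order 0 * d.order3‖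
      ≤ 2 * sys.obar * (sys.obar * Fintype.card Λ) := by
    rw [← norm_neg, neg_sub]
    calc _ ≤ 2 * sys.obar ^ 2 * Fintype.card Λ := d.norm_comm_order_order3_le 0
      _ = _ := by ring
  exact rot_estimate (d.J 1) W (sys.order 0) d.order3 hG hΦ' (map_zero _) hW hB hA I_ne_zero hR
    (by positivity) (sys.norm_order_le 0) d.norm_order3_le hBA hWn hΦ1 n

/-- `(O)² (O^{(1)})^{2K} = (O^{(1)})^{2K+2} + (O^{(2)})² (O^{(1)})^{2K} + (O^{(3)})² (O^{(1)})^{2K}`.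
[cite: KomaTasaki1993, (6.11)] -/
theorem totSq_mul_pow (K : ℕ) : d.totSq * sys.order 0 ^ (2 * K) =
    sys.order 0 ^ (2 * K + 2) + sys.order 1 * sys.order 1 * sys.order 0 ^ (2 * K)
      + d.order3 * d.order3 * sys.order 0 ^ (2 * K) := by
  rw [totSq, add_mul, sys.orderSq_mul_pow]

/-- One peeling step of the `SU(2)` average (Tasaki 2019 §4.3 / KT93 (6.11)–(6.13) done
one factor `(O)²` at a time): with `W_j = ((O)²)^j`,
`(2K+1) Re⟪W_{j+1} (O^{(1)})^{2K}⟫ ≤ (2K+3) Re⟪W_j (O^{(1)})^{2K+2}⟫ + O(N^{2j+2K+1})`.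
[cite: KomaTasaki1993, Theorem 6.1 (6.11)–(6.14)] [cite: Tasaki2019Tower, §4.3 (proof of Theorem 3.4)] -/
theorem stepS {Φ : E} {EΛ μ : ℝ} (hΦ : IsLROEigenstate sys Φ EΛ μ) (hJ : d.J 1 Φ = 0)
    (j K : ℕ) :
    (2 * K + 1) * (⟪Φ, (d.totSq ^ (j + 1) * sys.order 0 ^ (2 * K)) Φ⟫_ℂ).re
      ≤ (2 * K + 3) * (⟪Φ, (d.totSq ^ j * sys.order 0 ^ (2 * K + 2)) Φ⟫_ℂ).re
        + 2 * ((3 * (sys.obar * Fintype.card Λ) ^ 2) ^ j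
          * ((2 * K + 1) ^ 2 * (2 * sys.obar) * (sys.obar * Fintype.card Λ) ^ (2 * K + 1))) := by
  have hsplit : d.totSq ^ (j + 1) * sys.order 0 ^ (2 * K) =
      d.totSq ^ j * sys.order 0 ^ (2 * K + 2)
        + d.totSq ^ j * (sys.order 1 * sys.order 1 * sys.order 0 ^ (2 * K))
        + d.totSq ^ j * (d.order3 * d.order3 * sys.order 0 ^ (2 * K)) := by
    rw [pow_succ, mul_assoc, totSq_mul_pow, mul_add, mul_add]
  have hW : Commute sys.C (d.totSq ^ j) := d.commute_C_totSq.pow_right j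
  have hW' : Commute (d.J 1) (d.totSq ^ j) := d.commute_J1_totSq.pow_right j
  have hWn : ‖d.totSq ^ j‖ ≤ (3 * (sys.obar * Fintype.card Λ) ^ 2) ^ j :=
    norm_pow_le_of_le d.norm_totSq_le j
  have h2 := sys.rotC_estimate hΦ (d.totSq ^ j) hW hWn (2 * K + 1)
  have h3 := d.rotJ_estimate hΦ.norm_eq_one hJ (d.totSq ^ j) hW' hWn (2 * K + 1)
  rw [show 2 * K + 1 - 1 = 2 * K by omega] at h2 h3
  rw [hsplit, add_apply, add_apply, inner_add_right, inner_add_right, Complex.add_re,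
    Complex.add_re]
  push_cast at h2 h3 ⊢
  obtain ⟨h2a, h2b⟩ := abs_le.mp h2
  obtain ⟨h3a, h3b⟩ := abs_le.mp h3
  linarith

/-- Uniform bound for the peeling errors: for `a ≥ 1`, `K ≤ k`,
`(a R²)^{k-K} (2K+1)² 2o R^{2K+1} ≤ a^{k+1} (2k+2)² 2o R^{2k+1}`. [folklore] -/
private theorem peel_err_le {a o R : ℝ} (ha : 1 ≤ a) (ho : 0 ≤ o) (hR : 0 ≤ R) {k K : ℕ}
    (hK : K ≤ k) :
    (a * R ^ 2) ^ (k - K) * ((2 * (K : ℝ) + 1) ^ 2 * (2 * o) * R ^ (2 * K + 1))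
      ≤ a ^ (k + 1) * ((2 * (k : ℝ) + 2) ^ 2 * (2 * o) * R ^ (2 * k + 1)) := by
  have e : (a * R ^ 2) ^ (k - K) * ((2 * (K : ℝ) + 1) ^ 2 * (2 * o) * R ^ (2 * K + 1))
      = a ^ (k - K) * ((2 * (K : ℝ) + 1) ^ 2 * (2 * o) * R ^ (2 * k + 1)) := by
    rw [mul_pow, ← pow_mul, show R ^ (2 * k + 1) = R ^ (2 * (k - K)) * R ^ (2 * K + 1) by
      rw [← pow_add]; congr 1; omega]
    ring
  rw [e]
  have h1 : a ^ (k - K) ≤ a ^ (k + 1) := pow_le_pow_right₀ ha (by omega)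
  have h2 : (2 * (K : ℝ) + 1) ^ 2 ≤ (2 * (k : ℝ) + 2) ^ 2 := by
    have : (K : ℝ) ≤ k := by exact_mod_cast hK
    nlinarith
  have h0 : 0 ≤ a ^ (k - K) := pow_nonneg (by linarith) _
  gcongr

/-- **KT93 Theorem 6.1 + Lemma 7.5 combined, finite-volume form** (the `SU(2)` moment bound): for an
LRO eigenstate `Φ` with `X^{(2)} Φ = 0`,
`Re ⟪Φ, Q^{k+1} Φ⟫ ≥ ((3 (μ o N)²)^{k+1} - 2(k+1) e_S)/(2k+3) - (k+1) e_Q`, where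
`e_S = 3^{k+1} (2k+2)² 2o (oN)^{2k+1}`, `e_Q = 4^{k+1} (2k+2)² 2o (oN)^{2k+1}`: the rotation average
gives `(2k+3) ⟨(O^{(1)})^{2k+2}⟩ ≈ ⟨((O)²)^{k+1}⟩ ≥ (3(μoN)²)^{k+1}` (Jensen) and the `U(1)` average
`⟨Q^{k+1}⟩ ≳ ⟨(O^{(1)})^{2k+2}⟩`.
[cite: KomaTasaki1993, Theorem 6.1 (6.14), Lemma 7.4 (7.15), Lemma 7.5 (7.18)] -/
theorem re_inner_orderSq_pow_ge [FiniteDimensional ℂ E] {Φ : E} {EΛ μ : ℝ}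
    (hΦ : IsLROEigenstate sys Φ EΛ μ) (hJ : d.J 1 Φ = 0) (k : ℕ) :
    ((3 * (μ * sys.obar * Fintype.card Λ) ^ 2) ^ (k + 1)
        - 2 * (k + 1) * (3 ^ (k + 1) * ((2 * (k : ℝ) + 2) ^ 2 * (2 * sys.obar)
            * (sys.obar * Fintype.card Λ) ^ (2 * k + 1)))) / (2 * k + 3)
      - (k + 1) * (4 ^ (k + 1) * ((2 * (k : ℝ) + 2) ^ 2 * (2 * sys.obar)
            * (sys.obar * Fintype.card Λ) ^ (2 * k + 1)))
      ≤ (⟪Φ, (sys.orderSq ^ (k + 1)) Φ⟫_ℂ).re := by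
  have ho : 0 ≤ sys.obar := sys.obar_pos.le
  set R : ℝ := sys.obar * Fintype.card Λ with hR_def
  have hR : 0 ≤ R := by positivity
  set eS : ℝ := 3 ^ (k + 1) * ((2 * (k : ℝ) + 2) ^ 2 * (2 * sys.obar) * R ^ (2 * k + 1))
    with heS_def
  set eQ : ℝ := 4 ^ (k + 1) * ((2 * (k : ℝ) + 2) ^ 2 * (2 * sys.obar) * R ^ (2 * k + 1))
    with heQ_def
  have heS0 : 0 ≤ eS := by positivity
  have heQ0 : 0 ≤ eQ := by positivity
  -- the `SU(2)` chain: `g₀ - 2K e_S ≤ (2K+1) X_K`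
  have keyS : ∀ K, K ≤ k + 1 →
      (⟪Φ, (d.totSq ^ (k + 1) * sys.order 0 ^ (2 * 0)) Φ⟫_ℂ).re - 2 * K * eS
        ≤ (2 * K + 1) * (⟪Φ, (d.totSq ^ (k + 1 - K) * sys.order 0 ^ (2 * K)) Φ⟫_ℂ).re := by
    intro K
    induction K with
    | zero => intro _; simp
    | succ K ih =>
      intro hK
      have ih' := ih (by omega)
      have hs := d.stepS hΦ hJ (k - K) K
      have he := peel_err_le (a := 3) (by norm_num) ho hR (k := k) (K := K) (by omega)
      rw [show k - K + 1 = k + 1 - K by omega, ← hR_def] at hs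
      rw [show k + 1 - (K + 1) = k - K by omega, show 2 * (K + 1) = 2 * K + 2 by ring]
      push_cast at hs ih' ⊢
      linarith
  have hS := keyS (k + 1) le_rfl
  rw [Nat.sub_self, Nat.mul_zero, pow_zero, pow_zero, mul_one, one_mul] at hS
  simp only [Nat.cast_add, Nat.cast_one] at hS
  -- Jensen for `(O)²`
  have hT1 : 3 * (μ * sys.obar * Fintype.card Λ) ^ 2 ≤ (⟪Φ, d.totSq Φ⟫_ℂ).re := by
    have hq := sys.re_inner_orderSq_ge hΦ
    have h3 : (⟪Φ, d.order3 (d.order3 Φ)⟫_ℂ).re = (⟪Φ, sys.order 0 (sys.order 0 Φ)⟫_ℂ).re := by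
      rw [d.inner_order3_sq_eq hJ]
    have hl := hΦ.lro
    rw [totSq, add_apply, inner_add_right, Complex.add_re, mul_apply_eq_comp, h3]
    linarith
  have hJen : (3 * (μ * sys.obar * Fintype.card Λ) ^ 2) ^ (k + 1)
      ≤ (⟪Φ, (d.totSq ^ (k + 1)) Φ⟫_ℂ).re :=
    (pow_le_pow_left₀ (by positivity) hT1 _).trans
      (pow_re_inner_le_re_inner_pow d.totSq d.isSymmetric_totSq
        (fun x => by rw [re_inner_totSq]; positivity) hΦ.norm_eq_one (k + 1))
  -- the `U(1)` chain with the product `b K = Π_{i<K} (2i+2)/(2i+1) ≥ 1`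
  set b : ℕ → ℝ := fun K => ∏ i ∈ range K, ((2 * (i : ℝ) + 2) / (2 * i + 1)) with hb_def
  have hb0 : b 0 = 1 := by simp [hb_def]
  have hb_succ : ∀ K, b (K + 1) = b K * ((2 * (K : ℝ) + 2) / (2 * K + 1)) := fun K => by
    simp only [hb_def]
    rw [prod_range_succ]
  have hf1 : ∀ K : ℕ, (1 : ℝ) ≤ (2 * (K : ℝ) + 2) / (2 * K + 1) := fun K => by
    rw [le_div_iff₀ (by positivity)]; linarith
  have hb1 : ∀ K, 1 ≤ b K := by
    intro K
    induction K with
    | zero => rw [hb0]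
    | succ K ih => rw [hb_succ]; nlinarith [hf1 K]
  have keyQ : ∀ K, K ≤ k + 1 →
      b K * (⟪Φ, (sys.orderSq ^ (k + 1 - K) * sys.order 0 ^ (2 * K)) Φ⟫_ℂ).re - b K * K * eQ
        ≤ (⟪Φ, (sys.orderSq ^ (k + 1) * sys.order 0 ^ (2 * 0)) Φ⟫_ℂ).re := by
    intro K
    induction K with
    | zero => intro _; simp [hb0]
    | succ K ih =>
      intro hK
      have ih' := ih (by omega)
      have hs := sys.stepQ hΦ (k - K) K
      have he := peel_err_le (a := 4) (by norm_num) ho hR (k := k) (K := K) (by omega)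
      rw [show k - K + 1 = k + 1 - K by omega, ← hR_def] at hs
      set f : ℝ := (2 * (K : ℝ) + 2) / (2 * K + 1) with hf_def
      rw [show k + 1 - (K + 1) = k - K by omega, show 2 * (K + 1) = 2 * K + 2 by ring, hb_succ]
      set X0 := (⟪Φ, (sys.orderSq ^ (k + 1 - K) * sys.order 0 ^ (2 * K)) Φ⟫_ℂ).re with hX0
      set X1 := (⟪Φ, (sys.orderSq ^ (k - K) * sys.order 0 ^ (2 * K + 2)) Φ⟫_ℂ).re with hX1
      set g0 := (⟪Φ, (sys.orderSq ^ (k + 1) * sys.order 0 ^ (2 * 0)) Φ⟫_ℂ).re with hg0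
      have hpos : (0 : ℝ) < 2 * K + 1 := by positivity
      have hbK : 1 ≤ b K := hb1 K
      push_cast at hs ih' ⊢
      obtain ⟨hsa, hsb⟩ := abs_le.mp hs
      -- `(2K+2) X1 - eQ ≤ (2K+1) X0`
      have key : (2 * (K : ℝ) + 2) * X1 - eQ ≤ (2 * K + 1) * X0 := by linarith
      have key' : f * X1 - eQ / (2 * K + 1) ≤ X0 := by
        rw [hf_def, div_mul_eq_mul_div, div_sub_div_same, div_le_iff₀ hpos]; linarith
      have s1 : b K * (f * X1 - eQ / (2 * K + 1)) ≤ b K * X0 :=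
        mul_le_mul_of_nonneg_left key' (by linarith)
      have s2 : b K * (eQ / (2 * K + 1)) ≤ b K * eQ :=
        mul_le_mul_of_nonneg_left (div_le_self heQ0 (by linarith)) (by linarith)
      have s3 : b K * ((K : ℝ) + 1) * eQ ≤ b K * f * ((K : ℝ) + 1) * eQ := by
        have h0 : 0 ≤ b K * ((K : ℝ) + 1) * eQ := by
          have : 0 ≤ b K := by linarith
          positivity
        have := hf1 K
        rw [← hf_def] at this
        nlinarith
      have e1 : b K * (f * X1 - eQ / (2 * K + 1)) = b K * f * X1 - b K * (eQ / (2 * K + 1)) := by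
        ring
      have e2 : b K * ((K : ℝ) + 1) * eQ = b K * K * eQ + b K * eQ := by ring
      linarith [s1, s2, s3, e1, e2, ih']
  have hQ := keyQ (k + 1) le_rfl
  rw [Nat.sub_self, Nat.mul_zero, pow_zero, pow_zero, mul_one, one_mul] at hQ
  simp only [Nat.cast_add, Nat.cast_one] at hQ
  -- `Re ⟪Q^{k+1}⟫ ≥ 0`
  have hQ0 : 0 ≤ (⟪Φ, (sys.orderSq ^ (k + 1)) Φ⟫_ℂ).re :=
    (pow_nonneg (by rw [sys.re_inner_orderSq]; positivity) _).trans
      (pow_re_inner_le_re_inner_pow sys.orderSq sys.isSymmetric_orderSq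
        (fun x => by rw [sys.re_inner_orderSq]; positivity) hΦ.norm_eq_one (k + 1))
  -- combine
  set y := (⟪Φ, (sys.order 0 ^ (2 * k + 2)) Φ⟫_ℂ).re with hy
  have e22 : 2 * (k + 1) = 2 * k + 2 := by ring
  rw [e22] at hS hQ
  have hk3 : (0 : ℝ) < 2 * k + 3 := by positivity
  have hy1 : ((3 * (μ * sys.obar * Fintype.card Λ) ^ 2) ^ (k + 1) - 2 * (k + 1) * eS) / (2 * k + 3)
      ≤ y := by
    rw [div_le_iff₀ hk3]
    have e3 : (2 * ((k : ℝ) + 1) + 1) = 2 * k + 3 := by ring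
    rw [e3] at hS
    linarith
  have hbk := hb1 (k + 1)
  by_cases hy0 : 0 ≤ y - (k + 1) * eQ
  · have : y - (k + 1) * eQ ≤ b (k + 1) * (y - (k + 1) * eQ) :=
      le_mul_of_one_le_left hy0 hbk
    have e4 : b (k + 1) * (y - (k + 1) * eQ) = b (k + 1) * y - b (k + 1) * (k + 1) * eQ := by ring
    linarith
  · push Not at hy0
    linarith

/-- **`‖(O^+)^{k+1} Φ‖²` under `SU(2)`** (KT93 (7.15), (7.18) with Theorem 6.1):
`‖(O^+)^{k+1} Φ‖² ≥ Re ⟪Φ, Q^{k+1} Φ⟫ - (k+1)² o (2oN)^{2k+1}`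
`≥ ((3(μoN)²)^{k+1} - 2(k+1) e_S)/(2k+3) - (k+1) e_Q - (k+1)² o (2oN)^{2k+1}`.
[cite: KomaTasaki1993, Theorem 6.1, Lemma 7.5 (7.18), (7.26)] -/
theorem norm_sq_orderPlus_pow_ge [FiniteDimensional ℂ E] {Φ : E} {EΛ μ : ℝ}
    (hΦ : IsLROEigenstate sys Φ EΛ μ) (hJ : d.J 1 Φ = 0) (k : ℕ) :
    ((3 * (μ * sys.obar * Fintype.card Λ) ^ 2) ^ (k + 1)
        - 2 * (k + 1) * (3 ^ (k + 1) * ((2 * (k : ℝ) + 2) ^ 2 * (2 * sys.obar)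
            * (sys.obar * Fintype.card Λ) ^ (2 * k + 1)))) / (2 * k + 3)
      - (k + 1) * (4 ^ (k + 1) * ((2 * (k : ℝ) + 2) ^ 2 * (2 * sys.obar)
            * (sys.obar * Fintype.card Λ) ^ (2 * k + 1)))
      - ((k : ℝ) + 1) ^ 2 * sys.obar * (2 * sys.obar * Fintype.card Λ) ^ (2 * k + 1)
      ≤ ‖(sys.orderPlus ^ (k + 1)) Φ‖ ^ 2 := by
  have hα : 0 ≤ 2 * sys.obar * Fintype.card Λ := by
    have := sys.obar_pos.le; positivity
  have h1 : ‖(sys.orderPlus ^ (k + 1)) Φ‖ ^ 2 =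
      (⟪Φ, (sys.orderMinus ^ (k + 1) * sys.orderPlus ^ (k + 1)) Φ⟫_ℂ).re := by
    rw [mul_apply_eq_comp, ← sys.inner_orderPlus_pow_left, inner_self_eq_norm_sq_to_K]
    norm_cast
  have hAB : ‖sys.orderMinus * sys.orderPlus - sys.orderSq‖
      ≤ sys.obar * (2 * sys.obar * Fintype.card Λ) := by
    rw [sys.orderMinus_mul_orderPlus, add_sub_cancel_left, norm_smul, Complex.norm_I, one_mul]
    calc ‖sys.orderComm‖ ≤ 2 * sys.obar ^ 2 * Fintype.card Λ := sys.norm_orderComm_le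
      _ = sys.obar * (2 * sys.obar * Fintype.card Λ) := by ring
  have h2 := norm_pow_mul_pow_sub_pow_le sys.orderMinus sys.orderPlus sys.orderSq hα
    sys.obar_pos.le sys.norm_orderMinus_le sys.norm_orderPlus_le sys.norm_orderSq_le hAB
    sys.norm_orderMinus_comm_orderSq_le k
  have h3 := d.re_inner_orderSq_pow_ge hΦ hJ k
  have h4 := re_inner_ge_sub_norm (sys.orderMinus ^ (k + 1) * sys.orderPlus ^ (k + 1))
    (sys.orderSq ^ (k + 1)) hΦ.norm_eq_one
  rw [h1]
  linarith

/-- The mirror bound for `‖(O^-)^{k+1} Φ‖²` under `SU(2)`.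
[cite: KomaTasaki1993, Theorem 6.1, Lemma 7.5 (7.18)–(7.19), (7.26)] -/
theorem norm_sq_orderMinus_pow_ge [FiniteDimensional ℂ E] {Φ : E} {EΛ μ : ℝ}
    (hΦ : IsLROEigenstate sys Φ EΛ μ) (hJ : d.J 1 Φ = 0) (k : ℕ) :
    ((3 * (μ * sys.obar * Fintype.card Λ) ^ 2) ^ (k + 1)
        - 2 * (k + 1) * (3 ^ (k + 1) * ((2 * (k : ℝ) + 2) ^ 2 * (2 * sys.obar)
            * (sys.obar * Fintype.card Λ) ^ (2 * k + 1)))) / (2 * k + 3)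
      - (k + 1) * (4 ^ (k + 1) * ((2 * (k : ℝ) + 2) ^ 2 * (2 * sys.obar)
            * (sys.obar * Fintype.card Λ) ^ (2 * k + 1)))
      - ((k : ℝ) + 1) ^ 2 * sys.obar * (2 * sys.obar * Fintype.card Λ) ^ (2 * k + 1)
      ≤ ‖(sys.orderMinus ^ (k + 1)) Φ‖ ^ 2 := by
  have hα : 0 ≤ 2 * sys.obar * Fintype.card Λ := by
    have := sys.obar_pos.le; positivity
  have h1 : ‖(sys.orderMinus ^ (k + 1)) Φ‖ ^ 2 =
      (⟪Φ, (sys.orderPlus ^ (k + 1) * sys.orderMinus ^ (k + 1)) Φ⟫_ℂ).re := by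
    rw [mul_apply_eq_comp, ← sys.inner_orderMinus_pow_left, inner_self_eq_norm_sq_to_K]
    norm_cast
  have hAB : ‖sys.orderPlus * sys.orderMinus - sys.orderSq‖
      ≤ sys.obar * (2 * sys.obar * Fintype.card Λ) := by
    rw [sys.orderPlus_mul_orderMinus, sub_sub_cancel_left, norm_neg, norm_smul, Complex.norm_I,
      one_mul]
    calc ‖sys.orderComm‖ ≤ 2 * sys.obar ^ 2 * Fintype.card Λ := sys.norm_orderComm_le
      _ = sys.obar * (2 * sys.obar * Fintype.card Λ) := by ring
  have h2 := norm_pow_mul_pow_sub_pow_le sys.orderPlus sys.orderMinus sys.orderSq hα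
    sys.obar_pos.le sys.norm_orderPlus_le sys.norm_orderMinus_le sys.norm_orderSq_le hAB
    sys.norm_orderPlus_comm_orderSq_le k
  have h3 := d.re_inner_orderSq_pow_ge hΦ hJ k
  have h4 := re_inner_ge_sub_norm (sys.orderPlus ^ (k + 1) * sys.orderMinus ^ (k + 1))
    (sys.orderSq ^ (k + 1)) hΦ.norm_eq_one
  rw [h1]
  linarith

end SU2Datum

/-! ### Assembly (KT93 (7.25)–(7.26)) from an arbitrary moment lower bound -/

namespace U1System

variable (sys : U1System Λ E)

/-- **KT93 (7.25)–(7.26), abstract form**: for a `C`-eigenvector unit vector `Φ` and `k ≥ 1`, any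
common lower bound `L ≤ ‖(O^+)^k Φ‖²`, `L ≤ ‖(O^-)^k Φ‖²` gives
`0 ≤ Re (Ξ^{(k)}, O^{(1)} Ξ^{(k)})` and `L ≤ ((2k+1)/(2k) · Re (Ξ^{(k)}, O^{(1)} Ξ^{(k)}))^{2k}`
(charge bookkeeping + AM–GM with telescoping, as in `theorem_2_5_orderOne_fin`).
[cite: KomaTasaki1993, Theorem 7.3, (7.25)–(7.26)] -/
theorem theorem_2_5_orderOne_fin_of_le {Φ : E} {EΛ μ : ℝ}
    (hΦ : IsLROEigenstate sys Φ EΛ μ) (k : ℕ) (hk : 1 ≤ k) {L : ℝ}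
    (ha2 : L ≤ ‖(sys.orderPlus ^ k) Φ‖ ^ 2) (hb2 : L ≤ ‖(sys.orderMinus ^ k) Φ‖ ^ 2) :
    0 ≤ (⟪sys.xiState k Φ, sys.order 0 (sys.xiState k Φ)⟫_ℂ).re ∧
      L ≤ ((2 * k + 1) / (2 * k) * (⟪sys.xiState k Φ, sys.order 0 (sys.xiState k Φ)⟫_ℂ).re)
          ^ (2 * k) := by
  obtain ⟨c, hC⟩ := hΦ.eigen_C
  have hΦne : Φ ≠ 0 := by
    intro h0
    have h1 := hΦ.norm_eq_one
    rw [h0, norm_zero] at h1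
    exact zero_ne_one h1
  have hc : conj c = c := sys.conj_eq_of_eigen_C hΦne hC
  have hS := sys.re_inner_xiState_order_zero k hΦ.norm_eq_one hC hc
  have hS0 : 0 ≤ ∑ j ∈ range k, (‖(sys.orderPlus ^ (j + 1)) Φ‖ / ‖(sys.orderPlus ^ j) Φ‖
      + ‖(sys.orderMinus ^ (j + 1)) Φ‖ / ‖(sys.orderMinus ^ j) Φ‖) :=
    Finset.sum_nonneg fun j _ => add_nonneg (div_nonneg (norm_nonneg _) (norm_nonneg _))
      (div_nonneg (norm_nonneg _) (norm_nonneg _))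
  have hkpos : (0 : ℝ) < 2 * k + 1 := by positivity
  have hk2 : (0 : ℝ) < 2 * k := by
    have : (1 : ℝ) ≤ k := by exact_mod_cast hk
    linarith
  have hx0 : 0 ≤ (⟪sys.xiState k Φ, sys.order 0 (sys.xiState k Φ)⟫_ℂ).re := by
    by_contra hneg
    push Not at hneg
    have := mul_neg_of_pos_of_neg hkpos hneg
    linarith
  refine ⟨hx0, ?_⟩
  have hy : (2 * k + 1) / (2 * k) * (⟪sys.xiState k Φ, sys.order 0 (sys.xiState k Φ)⟫_ℂ).re
      = (∑ j ∈ range k, (‖(sys.orderPlus ^ (j + 1)) Φ‖ / ‖(sys.orderPlus ^ j) Φ‖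
          + ‖(sys.orderMinus ^ (j + 1)) Φ‖ / ‖(sys.orderMinus ^ j) Φ‖)) / (2 * k) := by
    rw [div_mul_eq_mul_div, hS]
  rw [hy]
  by_cases hL : L ≤ 0
  · exact hL.trans (pow_nonneg (div_nonneg hS0 hk2.le) _)
  push Not at hL
  have hak : (sys.orderPlus ^ k) Φ ≠ 0 := by
    intro h0
    rw [h0, norm_zero] at ha2
    have : (0 : ℝ) ^ 2 = 0 := by norm_num
    linarith
  have hbk : (sys.orderMinus ^ k) Φ ≠ 0 := by
    intro h0
    rw [h0, norm_zero] at hb2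
    have : (0 : ℝ) ^ 2 = 0 := by norm_num
    linarith
  have ha : ∀ j, j ≤ k → 0 < ‖(sys.orderPlus ^ j) Φ‖ :=
    fun j hj => norm_pos_iff.mpr (sys.plusPow_apply_ne_zero_of_le hak hj)
  have hb : ∀ j, j ≤ k → 0 < ‖(sys.orderMinus ^ j) Φ‖ :=
    fun j hj => norm_pos_iff.mpr (sys.minusPow_apply_ne_zero_of_le hbk hj)
  have hamgm := mul_le_pow_sum_div (fun j => ‖(sys.orderPlus ^ j) Φ‖)
    (fun j => ‖(sys.orderMinus ^ j) Φ‖) k (by omega) ha hb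
    (by simp [hΦ.norm_eq_one]) (by simp [hΦ.norm_eq_one])
  have hsq : Real.sqrt L ≤ ‖(sys.orderPlus ^ k) Φ‖ := Real.sqrt_le_iff.mpr ⟨norm_nonneg _, ha2⟩
  have hsq' : Real.sqrt L ≤ ‖(sys.orderMinus ^ k) Φ‖ := Real.sqrt_le_iff.mpr ⟨norm_nonneg _, hb2⟩
  have hprod : L ≤ ‖(sys.orderPlus ^ k) Φ‖ * ‖(sys.orderMinus ^ k) Φ‖ := by
    rw [← Real.mul_self_sqrt hL.le]
    exact mul_le_mul hsq hsq' (Real.sqrt_nonneg _) (norm_nonneg _)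
  beta_reduce at hamgm
  exact hprod.trans hamgm

end U1System

namespace SU2Datum

variable {sys : U1System Λ E} (d : SU2Datum sys)

/-- Arithmetic of the error terms: the raw bound of `norm_sq_orderPlus_pow_ge` dominates the clean
one `(3(μoN)²)^{k+1}/(2k+3) - (8(k+1)² 3^{k+1} + 8(k+1)³ 4^{k+1} + (k+1)² 4^{k+1}) o^{2k+2} N^{2k+1}`.
[folklore] -/
private theorem clean_le_raw (μ o N : ℝ) (ho : 0 ≤ o) (hN : 0 ≤ N) (k : ℕ) :
    (3 * (μ * o * N) ^ 2) ^ (k + 1) / (2 * k + 3)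
        - (8 * ((k : ℝ) + 1) ^ 2 * 3 ^ (k + 1) + 8 * ((k : ℝ) + 1) ^ 3 * 4 ^ (k + 1)
            + ((k : ℝ) + 1) ^ 2 * 4 ^ (k + 1)) * o ^ (2 * k + 2) * N ^ (2 * k + 1)
      ≤ ((3 * (μ * o * N) ^ 2) ^ (k + 1)
          - 2 * (k + 1) * (3 ^ (k + 1) * ((2 * (k : ℝ) + 2) ^ 2 * (2 * o) * (o * N) ^ (2 * k + 1))))
            / (2 * k + 3)
        - (k + 1) * (4 ^ (k + 1) * ((2 * (k : ℝ) + 2) ^ 2 * (2 * o) * (o * N) ^ (2 * k + 1)))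
        - ((k : ℝ) + 1) ^ 2 * o * (2 * o * N) ^ (2 * k + 1) := by
  have hk3 : (0 : ℝ) < 2 * k + 3 := by positivity
  -- name the basic nonnegative block `P = o^{2k+2} N^{2k+1}`
  have hP : (o * N) ^ (2 * k + 1) * o = o ^ (2 * k + 2) * N ^ (2 * k + 1) := by
    rw [mul_pow]; ring
  have hP0 : 0 ≤ o ^ (2 * k + 2) * N ^ (2 * k + 1) := by positivity
  -- term 1: `2(k+1) e_S/(2k+3) ≤ e_S = 8(k+1)² 3^{k+1} P`
  have t1 : 2 * ((k : ℝ) + 1) * (3 ^ (k + 1) * ((2 * (k : ℝ) + 2) ^ 2 * (2 * o)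
      * (o * N) ^ (2 * k + 1))) / (2 * k + 3)
      ≤ 8 * ((k : ℝ) + 1) ^ 2 * 3 ^ (k + 1) * (o ^ (2 * k + 2) * N ^ (2 * k + 1)) := by
    rw [div_le_iff₀ hk3]
    have e : 3 ^ (k + 1) * ((2 * (k : ℝ) + 2) ^ 2 * (2 * o) * (o * N) ^ (2 * k + 1))
        = 8 * ((k : ℝ) + 1) ^ 2 * 3 ^ (k + 1) * (o ^ (2 * k + 2) * N ^ (2 * k + 1)) := by
      rw [← hP]; ring
    rw [e]
    have h0 : 0 ≤ 8 * ((k : ℝ) + 1) ^ 2 * 3 ^ (k + 1) * (o ^ (2 * k + 2) * N ^ (2 * k + 1)) := by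
      positivity
    nlinarith
  -- term 2: `(k+1) e_Q = 8(k+1)³ 4^{k+1} P`
  have t2 : ((k : ℝ) + 1) * (4 ^ (k + 1) * ((2 * (k : ℝ) + 2) ^ 2 * (2 * o) * (o * N) ^ (2 * k + 1)))
      = 8 * ((k : ℝ) + 1) ^ 3 * 4 ^ (k + 1) * (o ^ (2 * k + 2) * N ^ (2 * k + 1)) := by
    rw [← hP]; ring
  -- term 3: `(k+1)² o (2oN)^{2k+1} = (k+1)² 2^{2k+1} P ≤ (k+1)² 4^{k+1} P`
  have t3 : ((k : ℝ) + 1) ^ 2 * o * (2 * o * N) ^ (2 * k + 1)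
      ≤ ((k : ℝ) + 1) ^ 2 * 4 ^ (k + 1) * (o ^ (2 * k + 2) * N ^ (2 * k + 1)) := by
    have e : ((k : ℝ) + 1) ^ 2 * o * (2 * o * N) ^ (2 * k + 1)
        = ((k : ℝ) + 1) ^ 2 * 2 ^ (2 * k + 1) * (o ^ (2 * k + 2) * N ^ (2 * k + 1)) := by
      rw [mul_assoc 2 o N, mul_pow, ← hP]; ring
    rw [e]
    have h2 : (2 : ℝ) ^ (2 * k + 1) ≤ 4 ^ (k + 1) := by
      rw [show (4 : ℝ) = 2 ^ 2 by norm_num, ← pow_mul]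
      exact pow_le_pow_right₀ (by norm_num) (by omega)
    have h0 : 0 ≤ ((k : ℝ) + 1) ^ 2 * (o ^ (2 * k + 2) * N ^ (2 * k + 1)) := by positivity
    nlinarith
  rw [sub_div] 
  nlinarith [t1, t2, t3, hP0]

/-- **KT94 Theorem 2.5 (2.30) with the `SU(2)` constant `√3`, finite-volume quantitative form —
PROVED** (KT93 Corollary 7.2 / Theorem 6.1 combined with (7.25)–(7.26); Tasaki 2019 Thm 3.4):
for a `U(1)` system with an `SU(2)` datum, an LRO eigenstate `Φ` (iv), (2.17)) annihilated by the
generators `X^{(1)}, X^{(2)}` (KT93 i'')), every `k ≥ 1` and every `N = |Λ|`: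
`0 ≤ Re (Ξ^{(k)}, O^{(1)} Ξ^{(k)})` and

  `(3 (μ o N)²)^k / (2k+1) - (8k² 3^k + 8k³ 4^k + k² 4^k) o^{2k} N^{2k-1}`
  `≤ ( (2k+1)/(2k) · Re (Ξ^{(k)}, O^{(1)} Ξ^{(k)}) )^{2k}`,

i.e. `N⁻¹ Re (Ξ^{(k)}, O^{(1)} Ξ^{(k)}) ≥ (2k/(2k+1)) (2k+1)^{-1/(2k)} √3 μ o (1 - O_k(N⁻¹))^{1/(2k)}`,
which tends to `√3 μ o` as `N → ∞` then `k → ∞` (`theorem_2_5_orderOne_su2_holds`).  The factor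
`1/(2k+1) = (4π)⁻¹ ∫_{S²} z^{2k} dΩ` is KT93's `G_k` ((6.9); Tasaki 2019 Lemma 4.3), obtained here
without integration from the commutator identities `⟨Φ, W [X, S] Φ⟩ = 0` (`X Φ = 0`,
`[X, W] = 0`) applied to the words `S = O^{(b)} (O^{(1)})^{2K-1}`, `W = ((O)²)^j`
(`SU2Datum.stepS`), and the `U(1)` factor `b_k ≥ 1` of KT93 Lemma 7.5 likewise (`U1System.stepQ`);
only `X^{(2)} = J 1` and `X^{(3)} = C` are used.  The error constant is explicit but far from optimal.
[cite: KomaTasaki1993, Corollary 7.2, Theorem 6.1, Theorem 7.3 (7.25)–(7.26)]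
[cite: KomaTasaki1994, Theorem 2.5 (2.30) and the remark following it]
[cite: Tasaki2019Tower, Theorem 3.4, §4.3] -/
theorem theorem_2_5_orderOne_fin [FiniteDimensional ℂ E] {Φ : E} {EΛ μ : ℝ}
    (hΦ : IsLROEigenstate sys Φ EΛ μ) (hJ : ∀ a, d.J a Φ = 0) (k : ℕ) (hk : 1 ≤ k) :
    0 ≤ (⟪sys.xiState k Φ, sys.order 0 (sys.xiState k Φ)⟫_ℂ).re ∧
      (3 * (μ * sys.obar * Fintype.card Λ) ^ 2) ^ k / (2 * k + 1)
          - (8 * (k : ℝ) ^ 2 * 3 ^ k + 8 * (k : ℝ) ^ 3 * 4 ^ k + (k : ℝ) ^ 2 * 4 ^ k)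
            * sys.obar ^ (2 * k) * (Fintype.card Λ : ℝ) ^ (2 * k - 1)
        ≤ ((2 * k + 1) / (2 * k) * (⟪sys.xiState k Φ, sys.order 0 (sys.xiState k Φ)⟫_ℂ).re)
          ^ (2 * k) := by
  obtain ⟨k, rfl⟩ : ∃ k', k = k' + 1 := ⟨k - 1, by omega⟩
  have ha2 := d.norm_sq_orderPlus_pow_ge hΦ (hJ 1) k
  have hb2 := d.norm_sq_orderMinus_pow_ge hΦ (hJ 1) k
  have hcl := clean_le_raw μ sys.obar (Fintype.card Λ : ℝ) sys.obar_pos.le (Nat.cast_nonneg _) k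
  obtain ⟨hx0, hfin⟩ := sys.theorem_2_5_orderOne_fin_of_le hΦ (k + 1) hk
    (hcl.trans ha2) (hcl.trans hb2)
  refine ⟨hx0, ?_⟩
  have e1 : 2 * (k + 1) - 1 = 2 * k + 1 := by omega
  have e2 : 2 * (k + 1) = 2 * k + 2 := by ring
  rw [e1]
  push_cast at hfin ⊢
  have e3 : (2 * ((k : ℝ) + 1) + 1) = 2 * k + 3 := by ring
  rw [e3] at hfin ⊢
  rw [e2] at hfin
  convert hfin using 2
  rw [e2]

end SU2Datum

/-! ### KT94 Theorem 2.5 (2.30), `SU(2)` case: the double limit with `√3` -/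

/-- `(1 + η)^n ≥ 1 + n η + n(n-1)/2 · η²` for `η ≥ 0`. [folklore] -/
private theorem one_add_pow_ge_quadratic {η : ℝ} (hη : 0 ≤ η) :
    ∀ n : ℕ, 1 + n * η + (n : ℝ) * ((n : ℝ) - 1) / 2 * η ^ 2 ≤ (1 + η) ^ n
  | 0 => by simp
  | n + 1 => by
    have ih := one_add_pow_ge_quadratic hη n
    have h1 : 0 ≤ (1 + η) := by linarith
    have h2 : (1 + η) * (1 + n * η + (n : ℝ) * ((n : ℝ) - 1) / 2 * η ^ 2) ≤ (1 + η) ^ (n + 1) := by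
      rw [pow_succ' (1 + η) n]
      exact mul_le_mul_of_nonneg_left ih h1
    have h3 : 0 ≤ (n : ℝ) * ((n : ℝ) - 1) / 2 * η ^ 3 := by
      have hn : 0 ≤ (n : ℝ) * ((n : ℝ) - 1) := by
        rcases Nat.eq_zero_or_pos n with h | h
        · simp [h]
        · have : (1 : ℝ) ≤ n := by exact_mod_cast h
          nlinarith
      positivity
    push_cast
    nlinarith

/-- For `a > 0`, `η > 0` and `k ≥ 3/η² + 1`: `(2k+1) a^{2k} < (a(1+η))^{2k}`. [folklore] -/
private theorem succ_mul_pow_lt {a η : ℝ} (ha : 0 < a) (hη : 0 < η) {k : ℕ} (hk1 : 1 ≤ k)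
    (hk : 3 / η ^ 2 ≤ k) : (2 * k + 1) * a ^ (2 * k) < (a * (1 + η)) ^ (2 * k) := by
  rw [mul_pow]
  have hq := one_add_pow_ge_quadratic hη.le (2 * k)
  push_cast at hq
  have hk' : (1 : ℝ) ≤ k := by exact_mod_cast hk1
  have hkη : 3 ≤ (k : ℝ) * η ^ 2 := by
    have := (div_le_iff₀ (by positivity : (0 : ℝ) < η ^ 2)).mp hk
    linarith
  -- `(1+η)^{2k} ≥ 1 + 2kη + k(2k-1)η² > 2k + 1`
  have h1 : (2 * (k : ℝ) + 1) < (1 + η) ^ (2 * k) := by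
    have : (2 * (k : ℝ)) * (2 * (k : ℝ) - 1) / 2 * η ^ 2 = k * η ^ 2 * (2 * k - 1) := by ring
    rw [this] at hq
    nlinarith
  have ha2 : 0 < a ^ (2 * k) := pow_pos ha _
  nlinarith

/-- **KT94 Theorem 2.5 (2.30), `SU(2)` case (`√3`)**, in `ε`–`k₀`–`N₀` form, uniformly over all `U(1)`
systems carrying an `SU(2)` datum, with order-operator bound `o = ob` and LRO parameter `μ`, whose
state is annihilated by the generators (KT93 i'')): for every `ε > 0` there is `k₀` such that for every
`k ≥ k₀` there is `N₀` with `N⁻¹ Re (Ξ^{(k)}, O^{(1)} Ξ^{(k)}) ≥ √3 μ o - ε` whenever `N ≥ N₀`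
(KT94, remark after Thm 2.5: "we replace `√2` with `√3` when the model has an `SU(2)` symmetry";
KT93 Corollary 7.2; Tasaki 2019 Theorem 3.4 `m* ≥ √(3 q₀)`).
[cite: KomaTasaki1994, Theorem 2.5 (2.30), remark] [cite: KomaTasaki1993, Corollary 7.2]
[cite: Tasaki2019Tower, Theorem 3.4] -/
def theorem_2_5_orderOne_su2 : Prop :=
  ∀ μ ob ε : ℝ, 0 < ε → ∃ k₀ : ℕ, ∀ k : ℕ, k₀ ≤ k → ∃ N₀ : ℕ,
    ∀ {Λ : Type u} [Fintype Λ] {E : Type v} [NormedAddCommGroup E] [InnerProductSpace ℂ E]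
      [FiniteDimensional ℂ E] (sys : U1System Λ E) (d : SU2Datum sys) (Φ : E) (EΛ : ℝ),
      IsLROEigenstate sys Φ EΛ μ → (∀ a, d.J a Φ = 0) → sys.obar = ob → N₀ ≤ Fintype.card Λ →
      Real.sqrt 3 * μ * ob - ε ≤
        (⟪sys.xiState k Φ, sys.order 0 (sys.xiState k Φ)⟫_ℂ).re / Fintype.card Λ

/-- **KT94 Theorem 2.5 (2.30), `SU(2)` case — PROVED** (from `SU2Datum.theorem_2_5_orderOne_fin`:
with `s = √3 μ o`, `a = s - ε/2`, `1 + η = s/a`, choose `k₀ ≥ s/ε` and `k₀ ≥ 3/η² + 1` so that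
`(2k+1) a^{2k} < s^{2k}`, then `N₀ > cst_k / (s^{2k}/(2k+1) - a^{2k})`).
[cite: KomaTasaki1994, Theorem 2.5 (2.30), remark] [cite: KomaTasaki1993, Corollary 7.2] -/
theorem theorem_2_5_orderOne_su2_holds : theorem_2_5_orderOne_su2.{u, v} := by
  intro μ ob ε hε
  set s : ℝ := Real.sqrt 3 * μ * ob with hs_def
  have hs2 : s ^ 2 = 3 * μ ^ 2 * ob ^ 2 := by
    rw [hs_def, mul_pow, mul_pow, Real.sq_sqrt (by norm_num : (0 : ℝ) ≤ 3)]
  by_cases hεs : s ≤ ε / 2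
  · refine ⟨1, fun k hk => ⟨0, ?_⟩⟩
    intro Λ _ E _ _ _ sys d Φ EΛ hΦ hJ _hob _hN
    have hx := (d.theorem_2_5_orderOne_fin hΦ hJ k hk).1
    have : 0 ≤ (⟪sys.xiState k Φ, sys.order 0 (sys.xiState k Φ)⟫_ℂ).re / Fintype.card Λ :=
      div_nonneg hx (Nat.cast_nonneg _)
    linarith
  push Not at hεs
  have hs : 0 < s := by linarith
  -- `a = s - ε/2`, `η = (ε/2)/a`
  set a : ℝ := s - ε / 2 with ha_def
  have ha : 0 < a := by rw [ha_def]; linarith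
  set η : ℝ := (ε / 2) / a with hη_def
  have hη : 0 < η := by positivity
  have hsa : s = a * (1 + η) := by
    rw [hη_def, mul_add, mul_one, mul_div_cancel₀ _ ha.ne']; ring
  refine ⟨max (⌈s / ε⌉₊ + 1) (⌈3 / η ^ 2⌉₊ + 1), fun k hk => ?_⟩
  have hk1 : 1 ≤ k := le_trans (by omega) ((le_max_left _ _).trans hk)
  have hkε : s ≤ k * ε := by
    have h1 : s / ε ≤ ⌈s / ε⌉₊ := Nat.le_ceil _
    have h2 : ((⌈s / ε⌉₊ + 1 : ℕ) : ℝ) ≤ k := by exact_mod_cast (le_max_left _ _).trans hk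
    push_cast at h2
    have h3 : s / ε ≤ k := by linarith
    rwa [div_le_iff₀ hε] at h3
  have hkη : 3 / η ^ 2 ≤ k := by
    have h1 : 3 / η ^ 2 ≤ ⌈3 / η ^ 2⌉₊ := Nat.le_ceil _
    have h2 : ((⌈3 / η ^ 2⌉₊ + 1 : ℕ) : ℝ) ≤ k := by exact_mod_cast (le_max_right _ _).trans hk
    push_cast at h2
    linarith
  -- the gap `G = s^{2k}/(2k+1) - a^{2k} > 0`
  have hgap : (2 * k + 1) * a ^ (2 * k) < s ^ (2 * k) := by
    rw [hsa]; exact succ_mul_pow_lt ha hη hk1 hkη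
  have hk21 : (0 : ℝ) < 2 * k + 1 := by positivity
  set G : ℝ := s ^ (2 * k) / (2 * k + 1) - a ^ (2 * k) with hG_def
  have hG : 0 < G := by
    rw [hG_def, sub_pos, lt_div_iff₀ hk21]; linarith
  set cst : ℝ := (8 * (k : ℝ) ^ 2 * 3 ^ k + 8 * (k : ℝ) ^ 3 * 4 ^ k + (k : ℝ) ^ 2 * 4 ^ k)
    * ob ^ (2 * k) with hcst_def
  refine ⟨⌈cst / G⌉₊ + 1, ?_⟩
  intro Λ _ E _ _ _ sys d Φ EΛ hΦ hJ hob hN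
  have hNpos : (0 : ℝ) < Fintype.card Λ := by
    have : 1 ≤ Fintype.card Λ := le_trans (by omega) hN
    exact_mod_cast Nat.lt_of_lt_of_le Nat.zero_lt_one this
  have hNG : cst ≤ Fintype.card Λ * G := by
    have h1 : cst / G ≤ ⌈cst / G⌉₊ := Nat.le_ceil _
    have h2 : ((⌈cst / G⌉₊ + 1 : ℕ) : ℝ) ≤ Fintype.card Λ := by exact_mod_cast hN
    push_cast at h2
    have h3 : cst / G ≤ Fintype.card Λ := by linarith
    rwa [div_le_iff₀ hG] at h3
  obtain ⟨hx0, hfin⟩ := d.theorem_2_5_orderOne_fin hΦ hJ k hk1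
  rw [hob] at hfin
  set N : ℝ := (Fintype.card Λ : ℝ) with hN_def
  set x : ℝ := (⟪sys.xiState k Φ, sys.order 0 (sys.xiState k Φ)⟫_ℂ).re with hx_def
  by_contra hcon
  push Not at hcon
  have hxlt : x < (s - ε) * N := by rwa [div_lt_iff₀ hNpos] at hcon
  have hsε : 0 < s - ε := by
    by_contra h
    push Not at h
    have : x < 0 := lt_of_lt_of_le hxlt (mul_nonpos_of_nonpos_of_nonneg h hNpos.le)
    linarith
  have hr0 : (0 : ℝ) < (2 * (k : ℝ) + 1) / (2 * (k : ℝ)) := by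
    have : (0 : ℝ) < k := by exact_mod_cast hk1
    positivity
  have hr : (2 * (k : ℝ) + 1) / (2 * (k : ℝ)) * ((s - ε) * N) ≤ a * N := by
    have hk0 : (0 : ℝ) < 2 * k := by
      have : (0 : ℝ) < k := by exact_mod_cast hk1
      linarith
    rw [div_mul_eq_mul_div, div_le_iff₀ hk0, ha_def]
    nlinarith
  have hrx : (2 * (k : ℝ) + 1) / (2 * (k : ℝ)) * x < a * N :=
    lt_of_lt_of_le (mul_lt_mul_of_pos_left hxlt hr0) hr
  have hpow : ((2 * (k : ℝ) + 1) / (2 * (k : ℝ)) * x) ^ (2 * k) < (a * N) ^ (2 * k) :=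
    pow_lt_pow_left₀ hrx (mul_nonneg hr0.le hx0) (by omega)
  -- `clean bound ≥ (a N)^{2k}` once `N G ≥ cst`
  obtain ⟨k', rfl⟩ : ∃ k', k = k' + 1 := ⟨k - 1, by omega⟩
  have e1 : 2 * (k' + 1) - 1 = 2 * k' + 1 := by omega
  rw [e1] at hfin
  have hkey : (3 * (μ * ob * N) ^ 2) ^ (k' + 1) / (2 * ((k' + 1 : ℕ) : ℝ) + 1)
      - (8 * ((k' + 1 : ℕ) : ℝ) ^ 2 * 3 ^ (k' + 1) + 8 * ((k' + 1 : ℕ) : ℝ) ^ 3 * 4 ^ (k' + 1)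
          + ((k' + 1 : ℕ) : ℝ) ^ 2 * 4 ^ (k' + 1)) * ob ^ (2 * (k' + 1)) * N ^ (2 * k' + 1)
      - (a * N) ^ (2 * (k' + 1)) = N ^ (2 * k' + 1) * (N * G - cst) := by
    have e3 : (3 * (μ * ob * N) ^ 2) ^ (k' + 1) = s ^ (2 * (k' + 1)) * N ^ (2 * (k' + 1)) := by
      have e4 : 3 * (μ * ob * N) ^ 2 = s ^ 2 * N ^ 2 := by rw [hs2]; ring
      rw [e4, mul_pow, ← pow_mul, ← pow_mul]
    rw [e3, hG_def, hcst_def, mul_pow a N]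
    field_simp
    ring
  have hLge : (a * N) ^ (2 * (k' + 1)) ≤ (3 * (μ * ob * N) ^ 2) ^ (k' + 1)
      / (2 * ((k' + 1 : ℕ) : ℝ) + 1)
      - (8 * ((k' + 1 : ℕ) : ℝ) ^ 2 * 3 ^ (k' + 1) + 8 * ((k' + 1 : ℕ) : ℝ) ^ 3 * 4 ^ (k' + 1)
          + ((k' + 1 : ℕ) : ℝ) ^ 2 * 4 ^ (k' + 1)) * ob ^ (2 * (k' + 1)) * N ^ (2 * k' + 1) := by
    have : 0 ≤ N ^ (2 * k' + 1) * (N * G - cst) :=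
      mul_nonneg (pow_nonneg hNpos.le _) (by linarith)
    linarith
  have := lt_of_le_of_lt (hLge.trans hfin) hpow
  exact lt_irrefl _ this

/-- **KT94 Theorem 2.5 (2.30) with `√3` along a sequence of lattices** (`SU(2)` case): for `U(1)`
systems with `SU(2)` data on lattices `Λ_j` with `N_j → ∞`, common `o` and `μ`, and states annihilated
by the generators, `∀ ε > 0, ∃ k₀, ∀ k ≥ k₀, ∀ᶠ j, N_j⁻¹ Re (Ξ^{(k)}_j, O^{(1)}_j Ξ^{(k)}_j) ≥ √3 μ o - ε`.
[cite: KomaTasaki1994, Theorem 2.5 (2.30), remark] [cite: KomaTasaki1993, Corollary 7.2]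
[cite: Tasaki2019Tower, Theorem 3.4] -/
theorem theorem_2_5_orderOne_su2_seq (Λ : ℕ → Type u) [∀ j, Fintype (Λ j)] (E : ℕ → Type v)
    [∀ j, NormedAddCommGroup (E j)] [∀ j, InnerProductSpace ℂ (E j)]
    [∀ j, FiniteDimensional ℂ (E j)] (sys : ∀ j, U1System (Λ j) (E j))
    (d : ∀ j, SU2Datum (sys j)) (Φ : ∀ j, E j)
    (EΛ : ℕ → ℝ) (μ ob : ℝ) (hΦ : ∀ j, IsLROEigenstate (sys j) (Φ j) (EΛ j) μ)
    (hJ : ∀ j a, (d j).J a (Φ j) = 0)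
    (hob : ∀ j, (sys j).obar = ob) (hN : Tendsto (fun j => Fintype.card (Λ j)) atTop atTop) :
    ∀ ε : ℝ, 0 < ε → ∃ k₀ : ℕ, ∀ k : ℕ, k₀ ≤ k → ∀ᶠ j in atTop,
      Real.sqrt 3 * μ * ob - ε ≤
        (⟪(sys j).xiState k (Φ j), (sys j).order 0 ((sys j).xiState k (Φ j))⟫_ℂ).re
          / Fintype.card (Λ j) := by
  intro ε hε
  obtain ⟨k₀, hk₀⟩ := theorem_2_5_orderOne_su2_holds.{u, v} μ ob ε hε
  refine ⟨k₀, fun k hk => ?_⟩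
  obtain ⟨N₀, hN₀⟩ := hk₀ k hk
  filter_upwards [Filter.tendsto_atTop.mp hN N₀] with j hj
  exact hN₀ (sys j) (d j) (Φ j) (EΛ j) (hΦ j) (hJ j) (hob j) hj

end SU2

end Literature.MathematicalPhysics.QuantumLattice.KomaTasaki

end
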